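import Mathlib
import HarnessLib
import HarnessLib.Audit
import Summits.Langlands.Statement
import Literature.FieldTheory.AlgClosed.PadicAlgClEquivComplex
import Literature.NumberTheory.PAdicHodge.FontaineDpst
import Literature.NumberTheory.Automorphic.LocalLanglandsGLProofs
import Literature.NumberTheory.Automorphic.LocalConstantsProofs
import Summits.Langlands.Langlands.Theorems.EisensteinDegreeShiftSectorComplementStubAvatarConjugacy
import Literature.NumberTheory.GaloisRepresentations.WeilDeligneRepFrobSemisimpleProofs
import Literature.NumberTheory.Automorphic.IwahoriGL
import Literature.NumberTheory.Automorphic.EssConjSelfDual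
import Literature.NumberTheory.GaloisRepresentations.FramedRepTwist
import Summits.Langlands.Langlands.Theorems.RootDecomp1SatakePlacesAllData
import Summits.Langlands.Langlands.Theorems.GenericWDUnique
import HarnessLib.Audit.Status.Attr

/-!
Route: RetentionCarving

# Route RetentionCarving — Root decomposition of GL(n) reciprocity below the prime-switch node — the
monodromy core carved by the automorphic monodromy type of the place: retention at monodromic places
(open) plus monodromy-free rigidity (provable algebra)

Decomposition node of the Langlands root ladder (cell decomp-langlands, lens-6 «barrier-complement
carving», generation 3; RESIDUAL MODE, child of route-Langlands-RootDecomp1 rev 3 at its open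
monodromy residual GEN = stmt-Langlands-25107 / N = stmt-Langlands-23599). It suffices to show X =
the conjunction of RootDecomp1's items with GEN REPLACED by MonodromyRetention (Ret) and the
provable local algebra MonodromyFreeRigidity (MFR): B_w ∧ SemisimpleAvatar ∧
CuspidalAvatarIrreducible ∧ P ∧ G ∧ R ∧ S ∧ Ret ∧ RECGEN ∧ WDU ∧ MFR ∧ CRD. The cut is the
AUTOMORPHIC MONODROMY TYPE of the place v ∤ ℓ: S.N = 0 (π_v irreducibly induced from supercuspidals,
«U-locus») versus S.N ≠ 0 (π_v monodromic, «S-locus»), S the Frobenius-semisimple member of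
rec_v(π_v). On the U-locus the monodromy upgrade N is a THEOREM modulo RECGEN and MFR (no phantom
monodromy: rec_v(π_v) = (S.ρ, 0) generic admits no non-zero monodromy operator at all —
Brauer–Nesbitt + the generic-orbit theorem AHTW 2026 Prop 6.0.5, both proved in the tree); on the
S-locus the residual is Ret = GEN restricted to the monodromic places. Kernel
(nodes/lens-6-g3-RetentionCarving.lean, rc 0, 0 sorry, axioms standard): monodromyUpgrade_of_pieces
: Ret → RECGEN → WDU → MFR → N; noPhantom_of_pieces : RECGEN → MFR → NoPhantomMonodromy;
genericFibre_iff_retention : GEN ↔ Ret modulo {CRD, G, R, S, RECGEN, WDU, MFR};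
retention_of_langlands : Langlands → RECGEN → Ret; MFRProof.monodromyFreeRigidity_of :
Brauer–Nesbitt-type → generic-orbit-type → MFR.
WHY THIS IS NOVEL: the monodromy core N (stmt-Langlands-23599) of GL(n) local-global compatibility
is carved a SECOND time along the catalogued barrier
`Literature.Barriers.Langlands.MonodromyNotClosedUnderPadicLimits` — after RootDecomp1 rev 3's cut
GEN ∣ RECGEN ∣ WDU by WHAT can fail, now by WHERE it can bite: at places where the automorphic
parameter is MONODROMIC (S.N ≠ 0) the open content is `MonodromyRetention` (Ret, «ρ retains the
monodromy of π_v», the barrier's exact support), while at MONODROMY-FREE places (S.N = 0) the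
no-phantom-monodromy statement is a THEOREM modulo RECGEN and the provable-now Brauer–Nesbitt ∘
generic-orbit rigidity MFR (`noPhantom_of_pieces`, kernel) — so GEN 25107 is replaced by the
strictly weaker Ret plus a print support, and the U-locus content RootDecomp1 carried twice (in GEN
and in S 23600) is paid once. LINEAGE: NODE decomp-langlands-lens-6-g3 04:36:27Z (HOME/STATUS.md
L177; nodes/lens-6-g3-RetentionCarving.lean sha256 b8d0a2f8…, probes rc0 incl. drop-one / layer-2
batteries, BC7 Ret/MFR/NoPh CLEAN, kit natively certified binder_used 12/12, in_cone 15/15), CLEARED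
by decomp-langlands crit-1 CLEARED 2026-08-30T04:40:41Z (HOME/STATUS.md L181; HOME/CRITIC-LEDGER.md
row 43); filed by the cell's route-writer decomp-langlands-writer-1 (gen 2) as a CHILD route of
route-Langlands-RootDecomp1 rev 3 refining :GenericFibre 25107 (= TREE policy (ii); `--refines
route-Langlands-RootDecomp1:stmt-Langlands-25107` once gate #12 is live): items shared by id with
RootDecomp1 (B_w 17414, G = SemisimpleAvatar 23598, R = CuspidalAvatarIrreducible 23601, S =
SemisimpleMatchingOneDatum 23600, P 17534, SatakePlacesAllData 23602, RecRigidity 23603, RECGEN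
25108, WDU 2374, CRD 17930; W⁺ 17415 and L∤R 18084 kept ASIDE as internal AND-nodes exactly as in
RootDecomp1), NEW = Ret (crux r4) and MFR (support, provable now). BC1 = 6 open cruxes among the 12
binders of `closes` (B_w, G, R, P, S, Ret). Layer 2 of Ret (RegularMonodromyRetention ∧
MixedMonodromyRetention, `retention_iff_cells`) is typed and certified in the node but deliberately
NOT filed (tenure `--split` later). Census instrument of record: HOME/census/COSTUME-CENSUS-v5.md
sha256 4c4c938f4ba8bead62a8d95c7cee857e9c4443944275227b18353a92e3920031 (json a21ab992…). Rung
currency: rung 0 (first prover target = MFR, provable now from two tree theorems).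
Lean: Summit.Langlands.Langlands.Theses.RetentionCarving.closes (12 binders, all consumed) :
_root_.Langlands

Rationale: WHY THIS LINE. RootDecomp1 (lens-6 g0) carved the monodromy core N into GEN ∧ RECGEN ∧ WDU with GEN
— genericity of the Weil–Deligne fibre of ρ at EVERY v ∤ ℓ — as the open residual sitting inside the
barrier Literature.Barriers.Langlands.MonodromyNotClosedUnderPadicLimits. But the barrier only bites
where the automorphic parameter carries monodromy: if rec_v(π_v) has N = 0 then, given the
semisimple matching S and the genericity of rec (RECGEN), the Frobenius-semisimplification of
WD(ρ_v) has Weil action ≅ S.ρ (Brauer–Nesbitt), S.ρ admits no twisted type-(+1) endomorphism, hence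
no non-zero monodromy operator (the Weil–Deligne relation makes N such an endomorphism up to the
generic-orbit theorem), so WD(ρ_v)^{F-ss} ≅ S outright. The honest residual of the monodromy barrier
is therefore GEN AT THE π-MONODROMIC PLACES ONLY = Ret; the U-locus half is the provable support
MFR. The dial is automorphic-side (N of rec π_v), invariant under twists, base change/restriction,
cyclic automorphic induction (N of an induced parameter is the sum of conjugates), duals and
Rec-rigidity, so the cut is orbit-closed for the print transfer groupoid (census G2/G7); the
Galois-side dial N(ρ_v) = 0 would be WRONG (it contains the barrier's hard case: phantom loss of N
at a Steinberg place).
RANKED CRUXES. rank 2 B_w WeakGeometricAutomorphy (17414, lineage blocker, refined by lens-6 g2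
LieTypeCarving and lenses 1–5); rank 3 SemisimpleAvatar (25956); rank 4 Ret = MonodromyRetention
(NEW: the S-locus monodromy residual; replaces GEN 25107); rank 5 S = SemisimpleMatchingOneDatum
(23600); rank 6 P = PadicMemberCompatibility (17534); rank 7 CuspidalAvatarIrreducible (25957).
Supports: G, R, RECGEN, WDU, CRD (RootDecomp1's, by id), MFR = MonodromyFreeRigidity (NEW, provable
now: bc/MonodromyFreeRigidity_birth.lean, 2 stubs = 2 tree theorems, composition kernel-checked), W⁺
and L∤R internal and-nodes, N and GEN asides (derived).
KILL CRITERIA. A regular algebraic cuspidal π over a CM field with π_v monodromic (e.g. Steinberg)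
and an ℓ-adic avatar ρ whose WD(ρ_v) is NOT generic (N too small) refutes Ret and the summit's
direction (A) simultaneously — Ret is necessary (retention_of_langlands). MFR is a theorem
(refutation impossible unless the tree's AHTW2026_prop_6_0_5_generic_conj_holds or Brauer–Nesbitt is
wrong). The line dies as a DECOMPOSITION only if the critic shows Ret ≡ GEN modulo in-tree/print
facts: the node's genericFibre_iff_retention shows the equivalence needs S (open crux 23600) — GEN's
U-locus content (q-link-freeness of the semisimple fibre) is paid by S ∧ RECGEN, not by Ret.
NOT DECOMPOSED YET. Ret itself (sectors: polarizable RA over CM — Taylor–Yoshida / Caraiani, print;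
general RA over CM — open, = the S-locus part of ParahoricFibre's GenericMonodromy 10863 /
SmallRangeGenericMonodromy 18195; irregular / general K — behind SemisimpleAvatar); the v ∣ ℓ twin
(RootDecomp2's GEN_p 26482 admits the same carving with AHTW2026WeilDeligneAtP; not filed here to
keep the cone ≤ 6).
CHEAPEST FALSIFIER. n = 1: Ret vacuous (characters have N = 0), MFR = class field theory
trivialities; n = 2, K = ℚ, π of weight 2 with a Steinberg place p ≠ ℓ: Ret says N(ρ_f|_p) ≠ 0 —
Carayol / Deligne–Rapoport (Tate curve), consistent; run #h21_crux_probe on Ret / MFR (done: CLEAN,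
CLEAN).

Novelty: Searches RUN: rg/lean search in the tree for
'IsGeneric|GenericMonodromy|PrecI|nonempty_equiv_of_isFrobSemisimple|AHTW2026_prop_6_0_5|NoPhantom|monodromy_eq_zero_of_gap'
(tree: EisensteinMonodromy/ParahoricFibre GenericMonodromy 10863, SmallRangeGenericMonodromy 18195,
ParahoricOccurrence 18194; GenericWDUnique 2374;
WeilDeligneSemisimpleTraces.nonempty_equiv_of_isFrobSemisimple_of_trace_eq;
GenericWeilDeligneOrbitProofs.AHTW2026_prop_6_0_5_generic_conj_holds; crux idea
Cruxes/GaloisRepOfRegularAlgebraic/Ideas/generic-gap-no-monodromy.md = the same «generic gap kills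
monodromy» lever at UNRAMIFIED places, used there to trim Varma's ≺ leaf from crux 10785); ledger
negatives --problem Langlands (4 entries: 17212, 16822, 16951, 3797 — none on WD genericity /
monodromy); lit search 'Taylor Yoshida compatibility local global Langlands monodromy' [corpus:
paper:arxiv-math_0412357, paper:arxiv-1010.2188 (Caraiani 2012) p2-3, paper:arxiv-1411.2520 (Varma)
p25, paper:arxiv-1202.4683 (Caraiani ℓ = p)], lit search --hybrid 'monodromy operator N local-global
compatibility non-self-dual regular algebraic CM' [corpus: paper:arxiv-2407.00288,
paper:arxiv-2312.01551 (Matsumoto 2023)], lit galaxy search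
'Taylor-Yoshida|weight-monodromy|monodromy operator N' --star pdf (8 hits, none on GL_n local–global
compatibility: [galaxy:pdf:-8407343767006348280] etc. off-topic). Nearest prior art: RootDecomp1's
GEN (25107, lens-6 g0) and ParahoricFibre's GenericMonodromy (10863: CM ∧ RA, all places); the  [refs: paper:arxiv-math_0412357, paper:arxiv-1010.2188, paper:arxiv-1411.2520, paper:arxiv-1202.4683, paper:arxiv-2407.00288, paper:arxiv-2312.01551]

Barriers (technique_class: decomposition, local-global-compatibility, weil-deligne): - technique_class: decomposition, local-global-compatibility, weil-deligne, generic-parameters,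
brauer-nesbitt
- Literature.Barriers.Langlands.MonodromyNotClosedUnderPadicLimits
(`MonodromyNotClosedUnderPadicLimits_holds`, `not_ladicLimitsPreserveMonodromy`): CARVED ALONG — Ret
sits INSIDE its target by construction (it is the open-orbit condition exactly at the places where
the automorphic parameter has N ≠ 0: any proof must leave the limit/congruence technique class;
evasions named in the barrier file: geometry/nearby cycles on the polarizable sector
TaylorYoshida2007/Caraiani2012, level-sensitive lifting AllenNewton2020, Ihara-type arguments,
parahoric occurrence ParahoricFibre 18194); MFR and the derived U-locus node NoPhantomMonodromy sit
OUTSIDE (pure algebra on Frobenius-semisimple parameters: «N = 0» is a closed condition and is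
moreover forced by the semisimple part when rec is generic with N = 0 — the barrier quantifies over
families whose members carry N ≠ 0).
- Literature.Barriers.Langlands.NonRegularWeightBarrier / ShimuraVarietyRealizationBarrier /
TwistedEndoscopySelfDual / ResiduallyReducibleBarrier / TaylorWilesNumericalCoincidence: not carved
here; they sit on B_w, SemisimpleAvatar, CuspidalAvatarIrreducible and S exactly as in RootDecomp1
(placed there), and on Ret through its hypotheses (an avatar ρ must exist: Ret is silent where
SemisimpleAvatar fails).
- Literature.Barriers.Langlands.PatchingLocalComponentBarrier: Ret on the RA ∧ CM sector is attacked
i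

sub-problem: Langlands · status: draft · opened planner-decomp-langlands-writer-1-g2-0 2026-08-30T04:41:55Z · rev 2 · ledger route-Langlands-RetentionCarving
GENERATED by the gate from the ledger (D-0016/17). Provers cite these decls: `theorem foo : Summit.Langlands.Langlands.Theses.RetentionCarving.<Decl> := …` in Summits/Langlands/Langlands/Theorems/<Name>.lean.
-/

namespace Summit.Langlands.Langlands.Theses.RetentionCarving

open scoped BigOperators Topology Manifold Classical MeasureTheory ProbabilityTheory Matrix InnerProductSpace ComplexConjugate ContinuousMap
open Filter Set Function TopologicalSpace MeasureTheory

attribute [summit_statement] _root_.Langlands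

/-- item stmt-Langlands-17414 · crux · rank 2 · open
refined by: route-Langlands-HodgeTatePurityCarving [split, open]; route-Langlands-MotivicDictionarySplit [split, open]; route-Langlands-FrobeniusUnitCarving [split, open] · by planner
why it might fail: Automorphy lifting exists only for regular, residually adequate ρ over TR/CM fields and gives POTENTIAL automorphy (BLGGT 4.2.1, ten-author 6.1.1); irregular weights / general K have no engine even for n = 2.
sources: FontaineMazurGeometric1995, BuzzardGeeLMS2014, ACCGHLNSTT2023, BarnetlambEtAl2014, Kisin2009
[crux] B_w — Fontaine–Mazur–Langlands, almost-everywhere form, for every number field K and n ≥ 1: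
every irreducible ρ : Γ_K → GL_n(ℚ̄_ℓ) that is unramified a.e. and de Rham above ℓ (Fontaine's
pinned datum) is Satake–Frobenius compatible at almost all places with some L-algebraic cuspidal π
of GL_n(𝔸_K). Verbatim the statement `weakAutomorphy_of_stubs` of line `Sketch` of crux
stmt-Langlands-14328 (there derived from the Literature text lang.S03). Rec-free. [difficulty:
open-problem] -/
@[route_item "route-Langlands-RetentionCarving", crux]
def WeakGeometricAutomorphy : Prop :=
  ∀ (K : Type) [Field K] [NumberField K] (n : ℕ) (hcpt : Literature.NumberTheory.Automorphic.isCompact_glFiniteIntegralLevel n K), 0 < n → ∀ (ℓ : ℕ) [Fact ℓ.Prime] (ι : PadicAlgCl ℓ ≃+* ℂ) (ρ : Literature.NumberTheory.GaloisRepresentations.FramedGaloisRep K (PadicAlgCl ℓ) n), ρ.toGaloisRep.IsIrreducible → ((∀ᶠ v : IsDedekindDomain.HeightOneSpectrum (NumberField.RingOfIntegers K) in cofinite, ρ.IsUnramifiedAt v) ∧ ∀ (v : IsDedekindDomain.HeightOneSpectrum (NumberField.RingOfIntegers K)) (hv : ((ℓ : ℕ) : NumberField.RingOfIntegers K) ∈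 v.asIdeal), (Literature.NumberTheory.PAdicHodge.fontainePstAdicCompletion v ℓ hv).IsDeRhamFramed (ρ.toLocal v)) → ∃ π : Literature.NumberTheory.Automorphic.CuspidalAutomorphicRepData n K hcpt, π.1.IsLAlgebraic ∧ ∀ᶠ v : IsDedekindDomain.HeightOneSpectrum (NumberField.RingOfIntegers K) in cofinite, SatakeFrobCompatibleAt ι π.1 ρ v

/-- item stmt-Langlands-23598 · crux · rank 3 · open
refined by: route-Langlands-FunctorialPrimitivitySplit [split, draft] · by planner
why it might fail: No construction of any Galois representation for irregular L-algebraic π (Maass-type infinity components) or for K neither totally real nor CM — no Shimura variety or shtuka realises them.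
sources: HarrisLanTaylorThorneRMS2016, Scholze2015, BuzzardGeeLMS2014, Clozel1990AnnArbor
[crux] [NEW root-level piece, the existence half of W⁺; verbatim the registered stub
`Summit.Langlands.Langlands.Cruxes.SectorComplement.BirthSatakeAvatarExistence.stub_semisimpleAvatar`;
WEAKER than W⁺ (drops irreducibility) and than Langlands; leaf IDEA-NEEDED,
BARRIER(Literature.Barriers.Langlands.ShimuraVarietyRealizationBarrier, NonRegularWeightBarrier) on
the irregular / general-K sector, RA ∧ TR/CM sector closed-mod-print by the fact
`Literature.NumberTheory.Automorphic.exists_galoisRep_of_regularAlgebraic` (lang.S27; C- vs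
L-normalisation transport `arithFrobPolyOfSatake ι q n α` ↔ `… 1 α` to be supplied); critic: CLEARED
decomp-langlands-crit-1-g0 0 2026-08-30T01:15:58Z (pub/decomp-langlands/STATUS.md; CRITIC-LEDGER.md
row 01:15:58Z)] for every number field K, n ≥ 1, every L-algebraic cuspidal π of GL_n(𝔸_K) and every
(ℓ, ι) there is a SEMISIMPLE framed ρ : Γ_K → GL_n(ℚ̄_ℓ) Satake–Frobenius compatible with (π, ι) at
almost all places. [difficulty: open-problem] -/
@[route_item "route-Langlands-RetentionCarving", crux]
def SemisimpleAvatar : Prop :=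
  ∀ (K : Type) [Field K] [NumberField K] (n : ℕ) (hcpt : Literature.NumberTheory.Automorphic.isCompact_glFiniteIntegralLevel n K), 0 < n → ∀ (π : Literature.NumberTheory.Automorphic.CuspidalAutomorphicRepData n K hcpt), π.1.IsLAlgebraic → ∀ (ℓ : ℕ) [Fact ℓ.Prime] (ι : PadicAlgCl ℓ ≃+* ℂ), ∃ ρ : Literature.NumberTheory.GaloisRepresentations.FramedGaloisRep K (PadicAlgCl ℓ) n, ρ.toGaloisRep.IsSemisimple ∧ ∀ᶠ v : IsDedekindDomain.HeightOneSpectrum (NumberField.RingOfIntegers K) in cofinite, SatakeFrobCompatibleAt ι π.1 ρ v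

/-- item stmt-Langlands-27961 · crux · rank 4 · SPLIT (gen 1) into ThetaAccessibleRetention, ThetaDarkRetention + glue MonodromyRetention_of_split · direct attempts still welcome (low priority) · by planner
why it might fail: Open core of local–global compatibility at v ∤ ℓ: for non-polarizable regular π over CM only WD(ρ_v) ≺ rec(π_v) is known (Varma 2024 Thm 2, AHTW 2026 Cor 1.2.2); known ρ are ℓ-adic limits of polarizable ones and limits lose N (MonodromyNotClosedUnderPadicLimits); nothing off the patching range.
sources: VarmaFMS2024, arXiv:2607.11763, TaylorYoshida2007, Caraiani2012, AllenNewton2020, Allen2016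
[crux] [NEW · Ret, the S-LOCUS half of the monodromy core N (23599) / of GEN (25107) under the
carving by the automorphic monodromy type of the place (decomp-langlands lens-6 gen 3, node
nodes/lens-6-g3-RetentionCarving.lean); OPEN; WEAKER (GEN ⇒ Ret kernel `retention_of_genericFibre`;
Langlands ∧ RECGEN ⇒ Ret kernel `Cert.retention_of_langlands`; Ret ⇏ GEN without S: GEN's U-locus
content — q-link-freeness of the semisimple fibre — is not asserted); leaf ATTACKABLE on the
polarizable RA/CM sector (Taylor–Yoshida 2007, Caraiani 2012: print), IDEA-NEEDED on general RA ∧ CM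
(= S-locus part of ParahoricFibre.GenericMonodromy 10863 / SmallRangeGenericMonodromy 18195;
parahoric occurrence 18194 is the live lever) and behind SemisimpleAvatar elsewhere, INSTRUMENTABLE
instance-wise at n = 2 (Bianchi newform ↔ elliptic curve with multiplicative reduction:
Faltings–Serre + Tate curve), BARRIER
Literature.Barriers.Langlands.MonodromyNotClosedUnderPadicLimits (its exact support)] For every
reciprocity datum, L-algebraic cuspidal π, irreducible pinned-geometric ρ Satake–Frobenius
compatible a.e., v ∤ ℓ, local component π_v, Weil–Deligne representation W of ρ|_{W_{K_v}} with
ℂ-transport Wℂ and -/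
@[route_item "route-Langlands-RetentionCarving", crux]
def MonodromyRetention : Prop :=
  ∀ (K : Type) [Field K] [NumberField K] (Rec : ReciprocityData K) (n : ℕ) (hcpt : Literature.NumberTheory.Automorphic.isCompact_glFiniteIntegralLevel n K), 0 < n → ∀ (π : Literature.NumberTheory.Automorphic.CuspidalAutomorphicRepData n K hcpt), π.1.IsLAlgebraic → ∀ (ℓ : ℕ) [Fact ℓ.Prime] (ι : PadicAlgCl ℓ ≃+* ℂ) (ρ : Literature.NumberTheory.GaloisRepresentations.FramedGaloisRep K (PadicAlgCl ℓ) n), ρ.toGaloisRep.IsIrreducible → ((∀ᶠ v : IsDedekindDomain.HeightOneSpectrum (NumberField.RingOfIntegers K) in Filter.cofinite, ρ.IsUnramifiedAt v) ∧ ∀ (v : IsDedekindDomain.HeightOneSpectrum (NumberField.RingOfIntegers K)) (hv : ((ℓ : ℕ) : NumberField.RingOfIntegers K) ∈ v.asIdeal), (Literature.NumberTheory.PAdicHodge.fontainePstAdicCompletion v ℓ hv).IsDeRhamFramed (ρ.toLocal v)) → (∀ᶠ v : IsDedekindDomain.HeightOneSpectrum (NumberField.RingOfIntegers K) in Filter.cofinite,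 SatakeFrobCompatibleAt ι π.1 ρ v) → ∀ v : IsDedekindDomain.HeightOneSpectrum (NumberField.RingOfIntegers K), ((ℓ : ℕ) : NumberField.RingOfIntegers K) ∉ v.asIdeal → ∀ (πv : Literature.NumberTheory.Automorphic.SmoothIrrep (Matrix.GeneralLinearGroup (Fin n) (v.adicCompletion K))), π.1.HasLocalComponentAt v πv.ρ → ∀ (W : Literature.NumberTheory.GaloisRepresentations.WeilDeligneRep (v.adicCompletion K) (PadicAlgCl ℓ) (Fin n → (PadicAlgCl ℓ))) (Wℂ : Literature.NumberTheory.GaloisRepresentations.WeilDeligneRep (v.adicCompletion K) ℂ (Fin n → ℂ)), Literature.NumberTheory.GaloisRepresentations.IsWeilDeligneOfLadic (ρ.toLocal v).toWeilGroupHom W → W.IsTransportAlong (ι : PadicAlgCl ℓ →+* ℂ) Wℂ → ∀ (S : Literature.NumberTheory.GaloisRepresentations.WeilDeligneRep (v.adicCompletion K) ℂ (Fin n → ℂ)) (hS : S.IsFrobSemisimple), Quotient.mk (Literature.NumberTheory.Automorphic.frobSemisimpleWDSetoid (v.adicCompletion K) n) ⟨S, hS⟩ = (Rec.llc v).recGL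 n (Literature.NumberTheory.Automorphic.IrrClass.mk πv) → (∀ w : Literature.NumberTheory.GaloisRepresentations.WeilGroup (v.adicCompletion K), LinearMap.trace ℂ (Fin n → ℂ) (Wℂ.ρ w) = LinearMap.trace ℂ (Fin n → ℂ) (S.ρ w)) → S.N ≠ 0 → ∀ r₁ : Literature.NumberTheory.GaloisRepresentations.WeilDeligneRep (v.adicCompletion K) ℂ (Fin n → ℂ), r₁.IsFrobSemisimplificationOf Wℂ → ∀ f : (Fin n → ℂ) →ₗ[ℂ] (Fin n → ℂ), (∀ w : Literature.NumberTheory.GaloisRepresentations.WeilGroup (v.adicCompletion K), f ∘ₗ r₁.ρ w = ((Literature.NumberTheory.GaloisRepresentations.IsNonarchimedeanLocalField.residueFieldCard (v.adicCompletion K) : ℂ) ^ (Literature.NumberTheory.GaloisRepresentations.WeilGroup.deg w)) • (r₁.ρ w ∘ₗ f)) → f ∘ₗ r₁.N = r₁.N ∘ₗ f → f = 0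

-- parent: MonodromyRetention · child (gen 1)
/--     item stmt-Langlands-29946 · crux · rank 401 · open
    parent: MonodromyRetention · by planner
    why it might fail: Not false short of ¬Langlands (Ret ⇒ A, Langlands ∧ RECGEN ⇒ Ret in kernel); as a TARGET, N for p-adic/congruence LIMITS of θ-stable cohomology (irregular HMF: Newton 1409.6535 Thm 4 only partial; Bianchi beyond Allen–Newton 2020) needs the «new idea» Newton names.
    sources: Caraiani2012, Caraiani2014, TaylorYoshida2007, HarrisTaylorAMS2001, ClozelHarrisTaylor2008, Mok2014
[crux] [NEW · WEAKER · ATTACKABLE] A = Ret (RetentionCarving.MonodromyRetention,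
stmt-Langlands-27961: at a MONODROMIC place v ∤ ℓ — S ∈ rec_v(π_v) Frobenius-semisimple with S.N ≠ 0
and tr Wℂ = tr S — the Frobenius-semisimplification of WD(ρ|_{W_{K_v}}) ⊗_ι ℂ is GENERIC) RESTRICTED
to the θ-ACCESSIBLE cuspidal π: π.1 lies in the LEAST θ-saturated class of automorphic
representations of general linear groups (inlined impredicatively: «π lies in every class S that
(gen) contains every representation over a TOTALLY REAL field that is SELF-DUAL a.e. (Satake α ↦ α⁻¹
— Arthur's twisted-endoscopic class for GL_n ⋊ θ, θ(g) = ᵗg⁻¹, the VISIBLE side of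
`Literature.Barriers.Langlands.TwistedEndoscopySelfDual`), and is closed under (tw) a.e. twists of
cuspidal members by automorphic characters of GL₁, (dual) a.e. contragredients of cuspidal members,
(up) weak base change of cuspidal members to ANY finite overfield (`IsWeakBaseChangeLiftAE`,
Arthur–Clozel Ch. 3 (1.1)), (down) cuspidal weak base-change PREIMAGES, (ai) weak automorphic
induction of cuspidal members along any finite layer (Arthur–Clozel Ch. 3 Def. 6.1, inlined),
(aipre) cuspidal weak automorphic-induction PREIMAGES»). Conjugate-se -/
@[route_item "route-Langlands-RetentionCarving"]
def ThetaAccessibleRetention : Prop :=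
  ∀ (K : Type) [Field K] [NumberField K] (Rec : ReciprocityData K) (n : ℕ) (hcpt : Literature.NumberTheory.Automorphic.isCompact_glFiniteIntegralLevel n K), 0 < n → ∀ (π : Literature.NumberTheory.Automorphic.CuspidalAutomorphicRepData n K hcpt), π.1.IsLAlgebraic → (∀ S : (∀ (K : Type) [Field K] [NumberField K] (n : ℕ) (hcpt : Literature.NumberTheory.Automorphic.isCompact_glFiniteIntegralLevel n K), Literature.NumberTheory.Automorphic.AutomorphicRepData (Literature.NumberTheory.Automorphic.AutomorphyDatum.gl n K hcpt) → Prop), ((∀ (K : Type) [Field K] [NumberField K] (n : ℕ) (hcpt : Literature.NumberTheory.Automorphic.isCompact_glFiniteIntegralLevel n K) (π : Literature.NumberTheory.Automorphic.AutomorphicRepData (Literature.NumberTheory.Automorphic.AutomorphyDatum.gl n K hcpt)), NumberField.IsTotallyReal K → (∀ᶠ v : IsDedekindDomain.HeightOneSpectrum (NumberField.RingOfIntegers K) in Filter.cofinite, ∀ α : Multiset ℂ, π.HasSatakeParamAt v α → π.HasSatakeParamAt v (α.map (·⁻¹))) → S K n hcpt π) ∧ (∀ (K : Type) [Field K] [NumberField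 K] (n : ℕ) (hcpt : Literature.NumberTheory.Automorphic.isCompact_glFiniteIntegralLevel n K) (h₁ : Literature.NumberTheory.Automorphic.isCompact_glFiniteIntegralLevel 1 K) (π₀ : Literature.NumberTheory.Automorphic.CuspidalAutomorphicRepData n K hcpt) (χ : Literature.NumberTheory.Automorphic.AutomorphicRepData (Literature.NumberTheory.Automorphic.AutomorphyDatum.gl 1 K h₁)) (P : Literature.NumberTheory.Automorphic.AutomorphicRepData (Literature.NumberTheory.Automorphic.AutomorphyDatum.gl n K hcpt)), (∀ᶠ v : IsDedekindDomain.HeightOneSpectrum (NumberField.RingOfIntegers K) in Filter.cofinite, ∀ (α : Multiset ℂ) (c : ℂ), π₀.1.HasSatakeParamAt v α → χ.HasSatakeParamAt v {c} → P.HasSatakeParamAt v (α.map (c * ·))) → S K n hcpt π₀.1 → S K n hcpt P) ∧ (∀ (K : Type) [Field K] [NumberField K] (n : ℕ) (hcpt : Literature.NumberTheory.Automorphic.isCompact_glFiniteIntegralLevel n K) (π₀ : Literature.NumberTheory.Automorphic.CuspidalAutomorphicRepData n K hcpt) (P : Literature.NumberTheory.Automorphic.AutomorphicRepData (Literature.NumberTheory.Automorphic.AutomorphyDatum.gl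 n K hcpt)), (∀ᶠ v : IsDedekindDomain.HeightOneSpectrum (NumberField.RingOfIntegers K) in Filter.cofinite, ∀ α : Multiset ℂ, π₀.1.HasSatakeParamAt v α → P.HasSatakeParamAt v (α.map (·⁻¹))) → S K n hcpt π₀.1 → S K n hcpt P) ∧ (∀ (K : Type) [Field K] [NumberField K] (M : Type) [Field M] [NumberField M] [Algebra K M] (n : ℕ) (hK : Literature.NumberTheory.Automorphic.isCompact_glFiniteIntegralLevel n K) (hM : Literature.NumberTheory.Automorphic.isCompact_glFiniteIntegralLevel n M) (π₀ : Literature.NumberTheory.Automorphic.CuspidalAutomorphicRepData n K hK) (P : Literature.NumberTheory.Automorphic.AutomorphicRepData (Literature.NumberTheory.Automorphic.AutomorphyDatum.gl n M hM)), Literature.NumberTheory.Automorphic.IsWeakBaseChangeLiftAE π₀.1 P → S K n hK π₀.1 → S M n hM P) ∧ (∀ (K : Type) [Field K] [NumberField K] (M : Type) [Field M] [NumberField M] [Algebra K M] (n : ℕ) (hK : Literature.NumberTheory.Automorphic.isCompact_glFiniteIntegralLevel n K) (hM : Literature.NumberTheory.Automorphic.isCompact_glFiniteIntegralLevel n M)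 (π : Literature.NumberTheory.Automorphic.AutomorphicRepData (Literature.NumberTheory.Automorphic.AutomorphyDatum.gl n K hK)) (P : Literature.NumberTheory.Automorphic.CuspidalAutomorphicRepData n M hM), Literature.NumberTheory.Automorphic.IsWeakBaseChangeLiftAE π P.1 → S M n hM P.1 → S K n hK π) ∧ (∀ (K : Type) [Field K] [NumberField K] (L : Type) [Field L] [NumberField L] [Algebra K L] (m n : ℕ) (hL : Literature.NumberTheory.Automorphic.isCompact_glFiniteIntegralLevel m L) (hK : Literature.NumberTheory.Automorphic.isCompact_glFiniteIntegralLevel n K) (σ : Literature.NumberTheory.Automorphic.CuspidalAutomorphicRepData m L hL) (π : Literature.NumberTheory.Automorphic.AutomorphicRepData (Literature.NumberTheory.Automorphic.AutomorphyDatum.gl n K hK)), (∀ᶠ v : IsDedekindDomain.HeightOneSpectrum (NumberField.RingOfIntegers K) in Filter.cofinite, ∀ β : IsDedekindDomain.HeightOneSpectrum (NumberField.RingOfIntegers L) → Multiset ℂ, (∀ w : IsDedekindDomain.HeightOneSpectrum (NumberField.RingOfIntegers L), w.asIdeal.under (NumberField.RingOfIntegers K) = v.asIdeal → σ.1.HasSatakeParamAt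 w (β w)) → ∃ α : Multiset ℂ, π.HasSatakeParamAt v α ∧ Literature.NumberTheory.Automorphic.satakePolynomial α = ∏ᶠ w ∈ {w : IsDedekindDomain.HeightOneSpectrum (NumberField.RingOfIntegers L) | w.asIdeal.under (NumberField.RingOfIntegers K) = v.asIdeal}, (Literature.NumberTheory.Automorphic.satakePolynomial (β w)).comp (Polynomial.X ^ w.asIdeal.inertiaDeg (NumberField.RingOfIntegers K))) → S L m hL σ.1 → S K n hK π) ∧ (∀ (K : Type) [Field K] [NumberField K] (L : Type) [Field L] [NumberField L] [Algebra K L] (m n : ℕ) (hL : Literature.NumberTheory.Automorphic.isCompact_glFiniteIntegralLevel m L) (hK : Literature.NumberTheory.Automorphic.isCompact_glFiniteIntegralLevel n K) (σ : Literature.NumberTheory.Automorphic.AutomorphicRepData (Literature.NumberTheory.Automorphic.AutomorphyDatum.gl m L hL)) (π : Literature.NumberTheory.Automorphic.CuspidalAutomorphicRepData n K hK), (∀ᶠ v : IsDedekindDomain.HeightOneSpectrum (NumberField.RingOfIntegers K) in Filter.cofinite, ∀ β : IsDedekindDomain.HeightOneSpectrum (NumberField.RingOfIntegers L) → Multiset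 ℂ, (∀ w : IsDedekindDomain.HeightOneSpectrum (NumberField.RingOfIntegers L), w.asIdeal.under (NumberField.RingOfIntegers K) = v.asIdeal → σ.HasSatakeParamAt w (β w)) → ∃ α : Multiset ℂ, π.1.HasSatakeParamAt v α ∧ Literature.NumberTheory.Automorphic.satakePolynomial α = ∏ᶠ w ∈ {w : IsDedekindDomain.HeightOneSpectrum (NumberField.RingOfIntegers L) | w.asIdeal.under (NumberField.RingOfIntegers K) = v.asIdeal}, (Literature.NumberTheory.Automorphic.satakePolynomial (β w)).comp (Polynomial.X ^ w.asIdeal.inertiaDeg (NumberField.RingOfIntegers K))) → S K n hK π.1 → S L m hL σ)) → S K n hcpt π.1) → ∀ (ℓ : ℕ) [Fact ℓ.Prime] (ι : PadicAlgCl ℓ ≃+* ℂ) (ρ : Literature.NumberTheory.GaloisRepresentations.FramedGaloisRep K (PadicAlgCl ℓ) n), ρ.toGaloisRep.IsIrreducible → ((∀ᶠ v : IsDedekindDomain.HeightOneSpectrum (NumberField.RingOfIntegers K) in Filter.cofinite, ρ.IsUnramifiedAt v) ∧ ∀ (v : IsDedekindDomain.HeightOneSpectrum (NumberField.RingOfIntegers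 K)) (hv : ((ℓ : ℕ) : NumberField.RingOfIntegers K) ∈ v.asIdeal), (Literature.NumberTheory.PAdicHodge.fontainePstAdicCompletion v ℓ hv).IsDeRhamFramed (ρ.toLocal v)) → (∀ᶠ v : IsDedekindDomain.HeightOneSpectrum (NumberField.RingOfIntegers K) in Filter.cofinite, SatakeFrobCompatibleAt ι π.1 ρ v) → ∀ v : IsDedekindDomain.HeightOneSpectrum (NumberField.RingOfIntegers K), ((ℓ : ℕ) : NumberField.RingOfIntegers K) ∉ v.asIdeal → ∀ (πv : Literature.NumberTheory.Automorphic.SmoothIrrep (Matrix.GeneralLinearGroup (Fin n) (v.adicCompletion K))), π.1.HasLocalComponentAt v πv.ρ → ∀ (W : Literature.NumberTheory.GaloisRepresentations.WeilDeligneRep (v.adicCompletion K) (PadicAlgCl ℓ) (Fin n → (PadicAlgCl ℓ))) (Wℂ : Literature.NumberTheory.GaloisRepresentations.WeilDeligneRep (v.adicCompletion K) ℂ (Fin n → ℂ)), Literature.NumberTheory.GaloisRepresentations.IsWeilDeligneOfLadic (ρ.toLocal v).toWeilGroupHom W → W.IsTransportAlong (ι : PadicAlgCl ℓ →+* ℂ)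 Wℂ → ∀ (S : Literature.NumberTheory.GaloisRepresentations.WeilDeligneRep (v.adicCompletion K) ℂ (Fin n → ℂ)) (hS : S.IsFrobSemisimple), Quotient.mk (Literature.NumberTheory.Automorphic.frobSemisimpleWDSetoid (v.adicCompletion K) n) ⟨S, hS⟩ = (Rec.llc v).recGL n (Literature.NumberTheory.Automorphic.IrrClass.mk πv) → (∀ w : Literature.NumberTheory.GaloisRepresentations.WeilGroup (v.adicCompletion K), LinearMap.trace ℂ (Fin n → ℂ) (Wℂ.ρ w) = LinearMap.trace ℂ (Fin n → ℂ) (S.ρ w)) → S.N ≠ 0 → ∀ r₁ : Literature.NumberTheory.GaloisRepresentations.WeilDeligneRep (v.adicCompletion K) ℂ (Fin n → ℂ), r₁.IsFrobSemisimplificationOf Wℂ → ∀ f : (Fin n → ℂ) →ₗ[ℂ] (Fin n → ℂ), (∀ w : Literature.NumberTheory.GaloisRepresentations.WeilGroup (v.adicCompletion K), f ∘ₗ r₁.ρ w = ((Literature.NumberTheory.GaloisRepresentations.IsNonarchimedeanLocalField.residueFieldCard (v.adicCompletion K) : ℂ) ^ (Literature.NumberTheory.GaloisRepresentations.WeilGroup.deg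 w)) • (r₁.ρ w ∘ₗ f)) → f ∘ₗ r₁.N = r₁.N ∘ₗ f → f = 0

-- parent: MonodromyRetention · child (gen 1)
/--     item stmt-Langlands-29947 · crux · rank 402 · open
    parent: MonodromyRetention · by planner
    why it might fail: Not false short of ¬Langlands; as a TARGET no method retains N off the θ-visible side: HLTT/Scholze reps come from an Eisenstein detour, Varma 2024 gives ≺ only; purity (IKM 2018, one GL₃ example) needs a geometric realisation nobody has in general.
    sources: VarmaFMS2024, HarrisLanTaylorThorne2016, Scholze2015, TaylorYoshida2007, arXiv:1811.11544, doi:10.1007/bf01232250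
[crux] [DECLARED RESIDUAL of this split · NEW · WEAKER · IDEA-NEEDED · INSIDE B7 (head-on) + B10] D
= Ret (RetentionCarving.MonodromyRetention, stmt-Langlands-27961) RESTRICTED to the θ-DARK cuspidal
π: π.1 is NOT in the least θ-saturated class (same inlined dial as ThetaAccessibleRetention,
negated) — π is unreachable from every self-dual representation over a totally real field by any
finite word in twists, duals, weak base change up, cuspidal base-change preimages, weak automorphic
induction and cuspidal induction preimages; over a totally real K this forces π NOT self-dual a.e.
(kernel `not_isSelfDualAE_of_not_isThetaAccessible`) = the INVISIBLE class of the twisted trace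
formula for GL_n ⋊ θ (`Literature.Barriers.Langlands.TwistedEndoscopySelfDual_holds`). WEAKER than
Ret (kernel `thetaDarkRetention_of_monodromyRetention`) hence than Langlands ∧ RECGEN; D ⇏ Ret, D ⇏
Langlands, D ⇏ A (probes FAIL); BC7 CLEAN. CONTENT: the Galois representations of θ-dark regular
algebraic π (n ≥ 3 not essentially self-dual over ℚ / CM: HLTT 2016, Scholze 2015) are built through
a θ-stable EISENSTEIN detour and only WD(ρ|_v)^{F-ss} ≺ rec(π_v) is known (Varma 2024) — the
monodromy is exactly what -/
@[route_item "route-Langlands-RetentionCarving"]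
def ThetaDarkRetention : Prop :=
  ∀ (K : Type) [Field K] [NumberField K] (Rec : ReciprocityData K) (n : ℕ) (hcpt : Literature.NumberTheory.Automorphic.isCompact_glFiniteIntegralLevel n K), 0 < n → ∀ (π : Literature.NumberTheory.Automorphic.CuspidalAutomorphicRepData n K hcpt), π.1.IsLAlgebraic → ¬ (∀ S : (∀ (K : Type) [Field K] [NumberField K] (n : ℕ) (hcpt : Literature.NumberTheory.Automorphic.isCompact_glFiniteIntegralLevel n K), Literature.NumberTheory.Automorphic.AutomorphicRepData (Literature.NumberTheory.Automorphic.AutomorphyDatum.gl n K hcpt) → Prop), ((∀ (K : Type) [Field K] [NumberField K] (n : ℕ) (hcpt : Literature.NumberTheory.Automorphic.isCompact_glFiniteIntegralLevel n K) (π : Literature.NumberTheory.Automorphic.AutomorphicRepData (Literature.NumberTheory.Automorphic.AutomorphyDatum.gl n K hcpt)), NumberField.IsTotallyReal K → (∀ᶠ v : IsDedekindDomain.HeightOneSpectrum (NumberField.RingOfIntegers K) in Filter.cofinite, ∀ α : Multiset ℂ, π.HasSatakeParamAt v α → π.HasSatakeParamAt v (α.map (·⁻¹))) → S K n hcpt π)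 ∧ (∀ (K : Type) [Field K] [NumberField K] (n : ℕ) (hcpt : Literature.NumberTheory.Automorphic.isCompact_glFiniteIntegralLevel n K) (h₁ : Literature.NumberTheory.Automorphic.isCompact_glFiniteIntegralLevel 1 K) (π₀ : Literature.NumberTheory.Automorphic.CuspidalAutomorphicRepData n K hcpt) (χ : Literature.NumberTheory.Automorphic.AutomorphicRepData (Literature.NumberTheory.Automorphic.AutomorphyDatum.gl 1 K h₁)) (P : Literature.NumberTheory.Automorphic.AutomorphicRepData (Literature.NumberTheory.Automorphic.AutomorphyDatum.gl n K hcpt)), (∀ᶠ v : IsDedekindDomain.HeightOneSpectrum (NumberField.RingOfIntegers K) in Filter.cofinite, ∀ (α : Multiset ℂ) (c : ℂ), π₀.1.HasSatakeParamAt v α → χ.HasSatakeParamAt v {c} → P.HasSatakeParamAt v (α.map (c * ·))) → S K n hcpt π₀.1 → S K n hcpt P) ∧ (∀ (K : Type) [Field K] [NumberField K] (n : ℕ) (hcpt : Literature.NumberTheory.Automorphic.isCompact_glFiniteIntegralLevel n K) (π₀ : Literature.NumberTheory.Automorphic.CuspidalAutomorphicRepData n K hcpt) (P : Literature.NumberTheory.Automorphic.AutomorphicRepData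 (Literature.NumberTheory.Automorphic.AutomorphyDatum.gl n K hcpt)), (∀ᶠ v : IsDedekindDomain.HeightOneSpectrum (NumberField.RingOfIntegers K) in Filter.cofinite, ∀ α : Multiset ℂ, π₀.1.HasSatakeParamAt v α → P.HasSatakeParamAt v (α.map (·⁻¹))) → S K n hcpt π₀.1 → S K n hcpt P) ∧ (∀ (K : Type) [Field K] [NumberField K] (M : Type) [Field M] [NumberField M] [Algebra K M] (n : ℕ) (hK : Literature.NumberTheory.Automorphic.isCompact_glFiniteIntegralLevel n K) (hM : Literature.NumberTheory.Automorphic.isCompact_glFiniteIntegralLevel n M) (π₀ : Literature.NumberTheory.Automorphic.CuspidalAutomorphicRepData n K hK) (P : Literature.NumberTheory.Automorphic.AutomorphicRepData (Literature.NumberTheory.Automorphic.AutomorphyDatum.gl n M hM)), Literature.NumberTheory.Automorphic.IsWeakBaseChangeLiftAE π₀.1 P → S K n hK π₀.1 → S M n hM P) ∧ (∀ (K : Type) [Field K] [NumberField K] (M : Type) [Field M] [NumberField M] [Algebra K M] (n : ℕ) (hK : Literature.NumberTheory.Automorphic.isCompact_glFiniteIntegralLevel n K) (hM : Literature.NumberTheory.Automorphic.isCompact_glFiniteIntegralLevel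 n M) (π : Literature.NumberTheory.Automorphic.AutomorphicRepData (Literature.NumberTheory.Automorphic.AutomorphyDatum.gl n K hK)) (P : Literature.NumberTheory.Automorphic.CuspidalAutomorphicRepData n M hM), Literature.NumberTheory.Automorphic.IsWeakBaseChangeLiftAE π P.1 → S M n hM P.1 → S K n hK π) ∧ (∀ (K : Type) [Field K] [NumberField K] (L : Type) [Field L] [NumberField L] [Algebra K L] (m n : ℕ) (hL : Literature.NumberTheory.Automorphic.isCompact_glFiniteIntegralLevel m L) (hK : Literature.NumberTheory.Automorphic.isCompact_glFiniteIntegralLevel n K) (σ : Literature.NumberTheory.Automorphic.CuspidalAutomorphicRepData m L hL) (π : Literature.NumberTheory.Automorphic.AutomorphicRepData (Literature.NumberTheory.Automorphic.AutomorphyDatum.gl n K hK)), (∀ᶠ v : IsDedekindDomain.HeightOneSpectrum (NumberField.RingOfIntegers K) in Filter.cofinite, ∀ β : IsDedekindDomain.HeightOneSpectrum (NumberField.RingOfIntegers L) → Multiset ℂ, (∀ w : IsDedekindDomain.HeightOneSpectrum (NumberField.RingOfIntegers L), w.asIdeal.under (NumberField.RingOfIntegers K) = v.asIdeal → σ.1.HasSatakeParamAt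 w (β w)) → ∃ α : Multiset ℂ, π.HasSatakeParamAt v α ∧ Literature.NumberTheory.Automorphic.satakePolynomial α = ∏ᶠ w ∈ {w : IsDedekindDomain.HeightOneSpectrum (NumberField.RingOfIntegers L) | w.asIdeal.under (NumberField.RingOfIntegers K) = v.asIdeal}, (Literature.NumberTheory.Automorphic.satakePolynomial (β w)).comp (Polynomial.X ^ w.asIdeal.inertiaDeg (NumberField.RingOfIntegers K))) → S L m hL σ.1 → S K n hK π) ∧ (∀ (K : Type) [Field K] [NumberField K] (L : Type) [Field L] [NumberField L] [Algebra K L] (m n : ℕ) (hL : Literature.NumberTheory.Automorphic.isCompact_glFiniteIntegralLevel m L) (hK : Literature.NumberTheory.Automorphic.isCompact_glFiniteIntegralLevel n K) (σ : Literature.NumberTheory.Automorphic.AutomorphicRepData (Literature.NumberTheory.Automorphic.AutomorphyDatum.gl m L hL)) (π : Literature.NumberTheory.Automorphic.CuspidalAutomorphicRepData n K hK), (∀ᶠ v : IsDedekindDomain.HeightOneSpectrum (NumberField.RingOfIntegers K) in Filter.cofinite, ∀ β : IsDedekindDomain.HeightOneSpectrum (NumberField.RingOfIntegers L) → Multiset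 ℂ, (∀ w : IsDedekindDomain.HeightOneSpectrum (NumberField.RingOfIntegers L), w.asIdeal.under (NumberField.RingOfIntegers K) = v.asIdeal → σ.HasSatakeParamAt w (β w)) → ∃ α : Multiset ℂ, π.1.HasSatakeParamAt v α ∧ Literature.NumberTheory.Automorphic.satakePolynomial α = ∏ᶠ w ∈ {w : IsDedekindDomain.HeightOneSpectrum (NumberField.RingOfIntegers L) | w.asIdeal.under (NumberField.RingOfIntegers K) = v.asIdeal}, (Literature.NumberTheory.Automorphic.satakePolynomial (β w)).comp (Polynomial.X ^ w.asIdeal.inertiaDeg (NumberField.RingOfIntegers K))) → S K n hK π.1 → S L m hL σ)) → S K n hcpt π.1) → ∀ (ℓ : ℕ) [Fact ℓ.Prime] (ι : PadicAlgCl ℓ ≃+* ℂ) (ρ : Literature.NumberTheory.GaloisRepresentations.FramedGaloisRep K (PadicAlgCl ℓ) n), ρ.toGaloisRep.IsIrreducible → ((∀ᶠ v : IsDedekindDomain.HeightOneSpectrum (NumberField.RingOfIntegers K) in Filter.cofinite, ρ.IsUnramifiedAt v) ∧ ∀ (v : IsDedekindDomain.HeightOneSpectrum (NumberField.RingOfIntegers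 K)) (hv : ((ℓ : ℕ) : NumberField.RingOfIntegers K) ∈ v.asIdeal), (Literature.NumberTheory.PAdicHodge.fontainePstAdicCompletion v ℓ hv).IsDeRhamFramed (ρ.toLocal v)) → (∀ᶠ v : IsDedekindDomain.HeightOneSpectrum (NumberField.RingOfIntegers K) in Filter.cofinite, SatakeFrobCompatibleAt ι π.1 ρ v) → ∀ v : IsDedekindDomain.HeightOneSpectrum (NumberField.RingOfIntegers K), ((ℓ : ℕ) : NumberField.RingOfIntegers K) ∉ v.asIdeal → ∀ (πv : Literature.NumberTheory.Automorphic.SmoothIrrep (Matrix.GeneralLinearGroup (Fin n) (v.adicCompletion K))), π.1.HasLocalComponentAt v πv.ρ → ∀ (W : Literature.NumberTheory.GaloisRepresentations.WeilDeligneRep (v.adicCompletion K) (PadicAlgCl ℓ) (Fin n → (PadicAlgCl ℓ))) (Wℂ : Literature.NumberTheory.GaloisRepresentations.WeilDeligneRep (v.adicCompletion K) ℂ (Fin n → ℂ)), Literature.NumberTheory.GaloisRepresentations.IsWeilDeligneOfLadic (ρ.toLocal v).toWeilGroupHom W → W.IsTransportAlong (ι : PadicAlgCl ℓ →+* ℂ)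 Wℂ → ∀ (S : Literature.NumberTheory.GaloisRepresentations.WeilDeligneRep (v.adicCompletion K) ℂ (Fin n → ℂ)) (hS : S.IsFrobSemisimple), Quotient.mk (Literature.NumberTheory.Automorphic.frobSemisimpleWDSetoid (v.adicCompletion K) n) ⟨S, hS⟩ = (Rec.llc v).recGL n (Literature.NumberTheory.Automorphic.IrrClass.mk πv) → (∀ w : Literature.NumberTheory.GaloisRepresentations.WeilGroup (v.adicCompletion K), LinearMap.trace ℂ (Fin n → ℂ) (Wℂ.ρ w) = LinearMap.trace ℂ (Fin n → ℂ) (S.ρ w)) → S.N ≠ 0 → ∀ r₁ : Literature.NumberTheory.GaloisRepresentations.WeilDeligneRep (v.adicCompletion K) ℂ (Fin n → ℂ), r₁.IsFrobSemisimplificationOf Wℂ → ∀ f : (Fin n → ℂ) →ₗ[ℂ] (Fin n → ℂ), (∀ w : Literature.NumberTheory.GaloisRepresentations.WeilGroup (v.adicCompletion K), f ∘ₗ r₁.ρ w = ((Literature.NumberTheory.GaloisRepresentations.IsNonarchimedeanLocalField.residueFieldCard (v.adicCompletion K) : ℂ) ^ (Literature.NumberTheory.GaloisRepresentations.WeilGroup.deg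 w)) • (r₁.ρ w ∘ₗ f)) → f ∘ₗ r₁.N = r₁.N ∘ₗ f → f = 0

-- parent: MonodromyRetention · glue (gen 1)
/--     item stmt-Langlands-29948 · support · rank 403 · closed · proved by Summit.Langlands.Langlands.Theorems.MonodromyRetention_of_split_proof (prover)
    parent: MonodromyRetention · GLUE: children ⟹ parent · by planner
ThetaAccessibleRetention → ThetaDarkRetention → MonodromyRetention — pure logic: one excluded middle
on the inlined θ-dial IsThetaAccessible π (lens-6-g5 node ThetaCarving.monodromyRetention_of_cells;
self-contained proof = PROOF section of nodes/lens-6-g5-ThetaCarving.split_glue.lean) -/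
@[route_item "route-Langlands-RetentionCarving"]
def MonodromyRetention_of_split : Prop :=
  ThetaAccessibleRetention → ThetaDarkRetention → MonodromyRetention

-- `MonodromyRetention_of_split` holds: proved by `Summit.Langlands.Langlands.Theorems.MonodromyRetention_of_split_proof` (its module imports this route file, so no `_holds` link can be stated here).

/-- item stmt-Langlands-23600 · crux · rank 5 · open
refined by: route-Langlands-IwahoriBlockSplit [split, draft] · by planner
why it might fail: Known only for regular algebraic π over TR/CM K (Varma 2024; polarizable: Harris–Taylor, Taylor–Yoshida); for irregular π or general K no avatar with controlled ramified traces exists — it inherits W⁺'s construction problem at the bad places.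
sources: TaylorGaloisRepresentations2004, VarmaFMS2024, HarrisTaylorAMS2001, Caraiani2012
[crux] [NEW root-level piece S = the Weil-group half of L∤R; verbatim the registered stub
`…Cruxes.CompatibilityAwayFromLR.Birth.stub_semisimpleMatchingOneDatum`; WEAKER than L∤R (Wℂ^F-ss ≅
S preserves traces; S does not return the monodromy) and than Langlands
(`compatibilityAwayFromLR_of_langlands`); OPEN; leaf IDEA-NEEDED, «no catalogued barrier» (the
avatar's construction sector inherits ShimuraVarietyRealization / NonRegularWeight); RA ∧ CM/TR
sector closed-mod-print by the fact `Varma2024.theorem12_trace_eq_and_precI`; critic: CLEARED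
crit-1-g0 2026-08-30T01:15:58Z] for every K carrying reciprocity data there is ONE pinned datum Rec₀
such that for every L-algebraic cuspidal π of GL_n(𝔸_K), every (ℓ, ι), every irreducible
pinned-geometric ρ Satake-compatible with (π, ι) a.e. and every exceptional place v ∤ ℓ there exist
the local component π_v, a Weil–Deligne module W of ρ|_W_v (Grothendieck), its transport Wℂ along ι
and a Frobenius-semisimple S ∈ rec_Rec₀,v(π_v) with tr Wℂ = tr S on W_K_v. [deps: SemisimpleAvatar]
[difficulty: open-problem] -/
@[route_item "route-Langlands-RetentionCarving", crux]
def SemisimpleMatchingOneDatum : Prop :=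
  ∀ (K : Type) [Field K] [NumberField K], Nonempty (ReciprocityData K) → ∃ Rec : ReciprocityData K, ∀ (n : ℕ) (hcpt : Literature.NumberTheory.Automorphic.isCompact_glFiniteIntegralLevel n K), 0 < n → ∀ (π : Literature.NumberTheory.Automorphic.CuspidalAutomorphicRepData n K hcpt), π.1.IsLAlgebraic → ∀ (ℓ : ℕ) [Fact ℓ.Prime] (ι : PadicAlgCl ℓ ≃+* ℂ) (ρ : Literature.NumberTheory.GaloisRepresentations.FramedGaloisRep K (PadicAlgCl ℓ) n), ρ.toGaloisRep.IsIrreducible → ((∀ᶠ v : IsDedekindDomain.HeightOneSpectrum (NumberField.RingOfIntegers K) in cofinite, ρ.IsUnramifiedAt v) ∧ ∀ (v : IsDedekindDomain.HeightOneSpectrum (NumberField.RingOfIntegers K)) (hv : ((ℓ : ℕ) : NumberField.RingOfIntegers K) ∈ v.asIdeal), (Literature.NumberTheory.PAdicHodge.fontainePstAdicCompletion v ℓ hv).IsDeRhamFramed (ρ.toLocal v)) → (∀ᶠ v : IsDedekindDomain.HeightOneSpectrum (NumberField.RingOfIntegers K) in cofinite, SatakeFrobCompatibleAt ι π.1 ρ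 v) → ∀ v : IsDedekindDomain.HeightOneSpectrum (NumberField.RingOfIntegers K), ((ℓ : ℕ) : NumberField.RingOfIntegers K) ∉ v.asIdeal → ¬ SatakeFrobCompatibleAt ι π.1 ρ v → ∃ (πv : Literature.NumberTheory.Automorphic.SmoothIrrep (Matrix.GeneralLinearGroup (Fin n) (v.adicCompletion K))) (W : Literature.NumberTheory.GaloisRepresentations.WeilDeligneRep (v.adicCompletion K) (PadicAlgCl ℓ) (Fin n → (PadicAlgCl ℓ))) (Wℂ : Literature.NumberTheory.GaloisRepresentations.WeilDeligneRep (v.adicCompletion K) ℂ (Fin n → ℂ)) (S : Literature.NumberTheory.GaloisRepresentations.WeilDeligneRep (v.adicCompletion K) ℂ (Fin n → ℂ)) (hS : S.IsFrobSemisimple), π.1.HasLocalComponentAt v πv.ρ ∧ Literature.NumberTheory.GaloisRepresentations.IsWeilDeligneOfLadic (ρ.toLocal v).toWeilGroupHom W ∧ W.IsTransportAlong (ι : PadicAlgCl ℓ →+* ℂ) Wℂ ∧ Quotient.mk (Literature.NumberTheory.Automorphic.frobSemisimpleWDSetoid (v.adicCompletion K) n) ⟨S, hS⟩ = (Rec.llc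 v).recGL n (Literature.NumberTheory.Automorphic.IrrClass.mk πv) ∧ ∀ w : Literature.NumberTheory.GaloisRepresentations.WeilGroup (v.adicCompletion K), LinearMap.trace ℂ (Fin n → ℂ) (Wℂ.ρ w) = LinearMap.trace ℂ (Fin n → ℂ) (S.ρ w)

/-- item stmt-Langlands-17534 · crux · rank 6 · open · by planner
why it might fail: ℓ = p compatibility for torsion-limit representations is known only up to semisimplification (AHTW 2026 Thm 1.2.1, regular π over CM); the monodromy at p, irregular π and general K are open.
sources: FontaineAsterisque223VIII, Caraiani2014, AHTW2026, arXiv:math/0612077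
[crux] P — the PRIME-SWITCH PRINCIPLE for the p-adic member of the automorphic compatible system
(Rec-parametric, Rec-free in content; rev 1, cone repair: stated over the summit's own predicates
only): for π L-algebraic cuspidal on GL_n/K, ρ an irreducible ℓ-adic avatar of (π, ι)
(Satake–Frobenius compatible a.e.) and a place v ∣ ℓ: (i) ρ|_v is de Rham for Fontaine's pinned
datum; (ii) for EVERY reciprocity datum Rec, every prime ℓ' ∤ v, ι' and every irreducible ℓ'-adic
avatar ρ' of (π, ι'), local–global compatibility of (π, ρ') at v for Rec (read ℓ'-adically,
Grothendieck–Deligne) implies local–global compatibility of (π, ρ) at v for Rec (read through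
D_pst). Mathematically (ii) is Fontaine's C_WD for the system {ρ_(π,ι)}: the
Frobenius-semisimplified Weil–Deligne representation at v of the p-adic member, computed by D_pst,
is the common one of the ℓ'-adic members (Saito arXiv:math/0612077 for Hilbert modular forms;
Caraiani 2012/2014 for Shimura varieties; AHTW 2026 Thm 1.2.1 up to semisimplification for regular π
over CM). Kernel-certified consequence of `Langlands` (bc/SubsOfLanglands.lean); with L∤ at (π, ι',
ρ') it is Taylor's Conj. 7 at v ∣ ℓ — the glue's patching lemma. -/
@[route_item "route-Langlands-RetentionCarving", crux]
def PadicMemberCompatibility : Prop :=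
  ∀ (K : Type) [Field K] [NumberField K] (n : ℕ) (hcpt : Literature.NumberTheory.Automorphic.isCompact_glFiniteIntegralLevel n K), 0 < n → ∀ (π : Literature.NumberTheory.Automorphic.CuspidalAutomorphicRepData n K hcpt), π.1.IsLAlgebraic → ∀ (ℓ : ℕ) [Fact ℓ.Prime] (ι : PadicAlgCl ℓ ≃+* ℂ) (ρ : Literature.NumberTheory.GaloisRepresentations.FramedGaloisRep K (PadicAlgCl ℓ) n), ρ.toGaloisRep.IsIrreducible → (∀ᶠ v : IsDedekindDomain.HeightOneSpectrum (NumberField.RingOfIntegers K) in cofinite, SatakeFrobCompatibleAt ι π.1 ρ v) → ∀ (v : IsDedekindDomain.HeightOneSpectrum (NumberField.RingOfIntegers K)) (hv : ((ℓ : ℕ) : NumberField.RingOfIntegers K) ∈ v.asIdeal), (Literature.NumberTheory.PAdicHodge.fontainePstAdicCompletion v ℓ hv).IsDeRhamFramed (ρ.toLocal v) ∧ ∀ (Rec : ReciprocityData K) (ℓ' : ℕ) [Fact ℓ'.Prime] (ι' : PadicAlgCl ℓ' ≃+* ℂ) (ρ' : Literature.NumberTheory.GaloisRepresentations.FramedGaloisRep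 K (PadicAlgCl ℓ') n), ((ℓ' : ℕ) : NumberField.RingOfIntegers K) ∉ v.asIdeal → ρ'.toGaloisRep.IsIrreducible → (∀ᶠ w : IsDedekindDomain.HeightOneSpectrum (NumberField.RingOfIntegers K) in cofinite, SatakeFrobCompatibleAt ι' π.1 ρ' w) → LocalGlobalCompatibleAt Rec ι' π.1 ρ' v → LocalGlobalCompatibleAt Rec ι π.1 ρ v

/-- item stmt-Langlands-23601 · crux · rank 7 · SPLIT (gen 1) into PolarizedShadowIrreducible, UnpolarizedSteinbergShadowIrreducible, RegularMonodromyNoSteinbergShadowIrreducible, UnpolarizedRegularShadowIrreducible, ShadowlessGenericIrreducible + glue CuspidalAvatarIrreducible_of_split · direct attempts still welcome (low priority) · by planner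
why it might fail: Open for n ≥ 4 in general even over ℚ with regular weight (only density-one sets of ℓ, Patrikis–Taylor); for irregular π there is not even a candidate argument, and potential automorphy of the summands is the missing input.
sources: Ramakrishnan2008Irreducibility, PatrikisTaylor2014, CalegariGee2013, BockleHui2025
[crux] [NEW root-level piece, the irreducibility half of W⁺; verbatim the registered stub
`…SectorComplement.BirthSatakeAvatarExistence.stub_cuspidalAvatarIrreducible`; WEAKER than Langlands
(necessity: a semisimple Satake-compatible ρ is conjugate to the irreducible avatar by Chebotarev +
Brauer–Nesbitt, cf. `SoloBlind.isIrreducible_of_eventually`); leaf IDEA-NEEDED, «no catalogued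
barrier»; known: n ≤ 3 (Ribet, Blasius–Rogawski), polarizable regular n ≤ 5 / density-one ℓ
(Calegari–Gee, Patrikis–Taylor, Böckle–Hui 2025); Rec-free root-level parent of the irreducibility
sector routes (IrreducibilityBySelfDuality, ExteriorSquareAscent, FrobeniusMoment); critic: CLEARED
decomp-langlands-crit-1-g0 0 2026-08-30T01:15:58Z (pub/decomp-langlands/STATUS.md; CRITIC-LEDGER.md
row 01:15:58Z)] every SEMISIMPLE framed ρ : Γ_K → GL_n(ℚ̄_ℓ) that is Satake–Frobenius compatible
a.e. with an L-algebraic CUSPIDAL (π, ι) is irreducible (Ramakrishnan's cuspidality ⇒ irreducibility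
conjecture, Satake-level form). [deps: SemisimpleAvatar] [difficulty: open-problem] -/
@[route_item "route-Langlands-RetentionCarving", crux]
def CuspidalAvatarIrreducible : Prop :=
  ∀ (K : Type) [Field K] [NumberField K] (n : ℕ) (hcpt : Literature.NumberTheory.Automorphic.isCompact_glFiniteIntegralLevel n K), 0 < n → ∀ (π : Literature.NumberTheory.Automorphic.CuspidalAutomorphicRepData n K hcpt), π.1.IsLAlgebraic → ∀ (ℓ : ℕ) [Fact ℓ.Prime] (ι : PadicAlgCl ℓ ≃+* ℂ) (ρ : Literature.NumberTheory.GaloisRepresentations.FramedGaloisRep K (PadicAlgCl ℓ) n), ρ.toGaloisRep.IsSemisimple → (∀ᶠ v : IsDedekindDomain.HeightOneSpectrum (NumberField.RingOfIntegers K) in cofinite, SatakeFrobCompatibleAt ι π.1 ρ v) → ρ.toGaloisRep.IsIrreducible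

-- parent: CuspidalAvatarIrreducible · child (gen 1)
/--     item stmt-Langlands-33110 · crux · rank 701 · open
    parent: CuspidalAvatarIrreducible · by planner
    why it might fail: Only with Irr itself: a reducible semisimple ρ Satake-compatible with a cuspidal π that becomes, over some M and up to twist, the avatar of a polarized regular P would contradict Ramakrishnan's conjecture; open for n ≥ 6 at general ℓ (CG13/Xia/Hui stop at n ≤ 6, a.a. λ).
    sources: CalegariGee2013, Hui2023, PatrikisTaylor2015, BarnetlambEtAl2014, TaylorYoshida2007, Caraiani2012
[crux] (POL-cell, child of CuspidalAvatarIrreducible = Irr stmt-Langlands-23601; lens-2-g9 node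
ShadowDepthTrichotomy; tags WEAKER · ATTACKABLE; layer 2) Irr — every number field K, every n, every
cuspidal L-algebraic π, every ℓ, ι — GIVEN Irr at every rank m < n over every number field (the rank
induction hypothesis, VERBATIM the clause of NRM 31315; it is what makes the cell SATURATED under
cyclic automorphic induction, see ORBIT) and restricted to the semisimple Satake-compatible ρ that
HAVE A POLARIZED REGULAR CM SHADOW (inlined dial PSH(ρ): ∃ CM field L, ∃ regular L-algebraic
cuspidal P on GL_n/L ‹of the class›, ∃ semisimple cofinitely-Satake-compatible avatar ρP of P, ∃
number field M ⊇ K, L, ∃ continuous η : Γ_M → ℚ̄_ℓˣ with ρ|Γ_M conjugate to (ρP|Γ_M) ⊗ η; classes: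
PSH = P norm-polarized (∃ m, P.1.IsEssConjSelfDual ‖·‖^m), SRS = P with a regular-monodromy place,
RS = any; PSH ⟹ RS ⟸ SRS; g8's SSH ⟹ PSH ∧ SRS; exact text = the statement / node defs).
ORBIT-CLOSED BY CONSTRUCTION (critic rows 6/74/83/99/105/109/114; cleared row 118): the ρ-dials are
∃(L,P,M,η)-saturated (⊗ Hecke character ↦ η; BC up ↦ M·K′; descent ↦ same witness); RM(π) is
cyclic-BC bi-invariant; rank-RAISIN -/
@[route_item "route-Langlands-RetentionCarving"]
def PolarizedShadowIrreducible : Prop :=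
  ∀ (K : Type) [Field K] [NumberField K] (n : ℕ) (hcpt : Literature.NumberTheory.Automorphic.isCompact_glFiniteIntegralLevel n K), 0 < n → ∀ (π : Literature.NumberTheory.Automorphic.CuspidalAutomorphicRepData n K hcpt), π.1.IsLAlgebraic → (∀ m : ℕ, m < n → ∀ (K : Type) [Field K] [NumberField K] (hcpt : Literature.NumberTheory.Automorphic.isCompact_glFiniteIntegralLevel m K), 0 < m → ∀ (π : Literature.NumberTheory.Automorphic.CuspidalAutomorphicRepData m K hcpt), π.1.IsLAlgebraic → ∀ (ℓ : ℕ) [Fact ℓ.Prime] (ι : PadicAlgCl ℓ ≃+* ℂ) (ρ : Literature.NumberTheory.GaloisRepresentations.FramedGaloisRep K (PadicAlgCl ℓ) m), ρ.toGaloisRep.IsSemisimple → (∀ᶠ v : IsDedekindDomain.HeightOneSpectrum (NumberField.RingOfIntegers K) in cofinite, SatakeFrobCompatibleAt ι π.1 ρ v) → ρ.toGaloisRep.IsIrreducible) → ∀ (ℓ : ℕ) [Fact ℓ.Prime] (ι : PadicAlgCl ℓ ≃+* ℂ) (ρ : Literature.NumberTheory.GaloisRepresentations.FramedGaloisRep K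 (PadicAlgCl ℓ) n), ρ.toGaloisRep.IsSemisimple → (∀ᶠ v : IsDedekindDomain.HeightOneSpectrum (NumberField.RingOfIntegers K) in cofinite, SatakeFrobCompatibleAt ι π.1 ρ v) → (∃ (L : Type) (_ : Field L) (_ : NumberField L) (_ : NumberField.IsCMField L) (hcptL : Literature.NumberTheory.Automorphic.isCompact_glFiniteIntegralLevel n L) (P : Literature.NumberTheory.Automorphic.CuspidalAutomorphicRepData n L hcptL), (∃ T : Literature.NumberTheory.Automorphic.InfinityType L n, P.1.HasInfinityType T ∧ T.IsLAlgebraic ∧ T.IsRegular) ∧ (∃ (χ : Literature.NumberTheory.GaloisRepresentations.HeckeCharacter L) (m : ℤ), (∀ x : Literature.NumberTheory.GaloisRepresentations.ideleGroup L, ((χ x : ℂˣ) : ℂ) = (Literature.NumberTheory.GaloisRepresentations.ideleNorm x : ℂ) ^ (m : ℂ)) ∧ P.1.IsEssConjSelfDual χ) ∧ ∃ ρP : Literature.NumberTheory.GaloisRepresentations.FramedGaloisRep L (PadicAlgCl ℓ) n, ρP.toGaloisRep.IsSemisimple ∧ (∀ᶠ u : IsDedekindDomain.HeightOneSpectrum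 (NumberField.RingOfIntegers L) in cofinite, SatakeFrobCompatibleAt ι P.1 ρP u) ∧ ∃ (M : Type) (_ : Field M) (_ : NumberField M) (_ : Algebra K M) (_ : Algebra L M) (η : ContinuousMonoidHom (Field.absoluteGaloisGroup M) (PadicAlgCl ℓ)ˣ), IsConjugate (ρ.restrictField M) ((ρP.restrictField M).twist η)) → ρ.toGaloisRep.IsIrreducible

-- parent: CuspidalAvatarIrreducible · child (gen 1)
/--     item stmt-Langlands-33111 · crux · rank 702 · open
    parent: CuspidalAvatarIrreducible · by planner
    why it might fail: For non-polarizable P′ over CM L only WD(r_ι(P′)|u) ≺ rec(P′_u) is known (Varma 2024 Thm 2; p-adic limits of polarizable reps can lose monodromy), and every in-print monodromy-lifting theorem (Allen–Newton 2020, Matsumoto 2023) presupposes residual irreducibility — circular at Eisenstein ℓ.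
    sources: VarmaFMS2024, AHTW2026, AllenNewton2020, arXiv:2312.01551, BockleHui2025, Shavali2026GL4
[crux] (LIM-cell = critic row 99 F1 «LIM»; child of CuspidalAvatarIrreducible = Irr
stmt-Langlands-23601, open sector of the g7 RM-cell 31314; lens-2-g9 node ShadowDepthTrichotomy;
tags WEAKER · IDEA-NEEDED inside BARRIER
`Literature.Barriers.Langlands.MonodromyNotClosedUnderPadicLimits`; layer 2) Irr for the cuspidal
L-algebraic π WITH a regular-monodromy place (inlined RM(π): ∃ finite v, π_v ≃ St_n ⊗ χ —
essentially discrete series with an Iwahori-fixed vector after a twist; the g7 dial of 31314,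
VERBATIM), GIVEN Irr at every rank m < n over every number field (the rank induction hypothesis
VERBATIM as in 31315 — every g9 cell carries it, see ORBIT (2)), for the semisimple
Satake-compatible ρ WITHOUT a polarized regular CM shadow but WITH a STEINBERG regular CM shadow
(inlined ¬PSH(ρ) ∧ SRS(ρ): ∃ CM field L, ∃ regular L-algebraic cuspidal P on GL_n/L ‹of the class›,
∃ semisimple cofinitely-Satake-compatible avatar ρP of P, ∃ number field M ⊇ K, L, ∃ continuous η :
Γ_M → ℚ̄_ℓˣ with ρ|Γ_M conjugate to (ρP|Γ_M) ⊗ η; classes: PSH = P norm-polarized (∃ m,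
P.1.IsEssConjSelfDual ‖·‖^m), SRS = P with a regular-monodromy place, RS = any; PSH ⟹ RS ⟸ SRS; g8's
SSH ⟹ PSH ∧ SRS; exact text = -/
@[route_item "route-Langlands-RetentionCarving"]
def UnpolarizedSteinbergShadowIrreducible : Prop :=
  ∀ (K : Type) [Field K] [NumberField K] (n : ℕ) (hcpt : Literature.NumberTheory.Automorphic.isCompact_glFiniteIntegralLevel n K), 0 < n → ∀ (π : Literature.NumberTheory.Automorphic.CuspidalAutomorphicRepData n K hcpt), π.1.IsLAlgebraic → (∃ (v : IsDedekindDomain.HeightOneSpectrum (NumberField.RingOfIntegers K)) (πv : Literature.NumberTheory.Automorphic.SmoothIrrep (Matrix.GeneralLinearGroup (Fin n) (v.adicCompletion K))), π.1.HasLocalComponentAt v πv.ρ ∧ (∀ [MeasurableSpace (Matrix.GeneralLinearGroup (Fin n) (v.adicCompletion K) ⧸ Subgroup.center (Matrix.GeneralLinearGroup (Fin n) (v.adicCompletion K)))] [BorelSpace (Matrix.GeneralLinearGroup (Fin n) (v.adicCompletion K) ⧸ Subgroup.center (Matrix.GeneralLinearGroup (Fin n) (v.adicCompletion K)))] (μ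 : MeasureTheory.Measure (Matrix.GeneralLinearGroup (Fin n) (v.adicCompletion K) ⧸ Subgroup.center (Matrix.GeneralLinearGroup (Fin n) (v.adicCompletion K)))) [μ.IsHaarMeasure], πv.ρ.IsEssentiallyDiscreteSeries μ) ∧ ∃ χ : Matrix.GeneralLinearGroup (Fin n) (v.adicCompletion K) →* ℂˣ, IsOpen (χ.ker : Set (Matrix.GeneralLinearGroup (Fin n) (v.adicCompletion K))) ∧ ∃ w : πv.V, w ≠ 0 ∧ ∀ g ∈ Literature.NumberTheory.Automorphic.iwahoriGL n (v.adicCompletion K), (πv.ρ.twist χ) g w = w) → (∀ m : ℕ, m < n → ∀ (K : Type) [Field K] [NumberField K] (hcpt : Literature.NumberTheory.Automorphic.isCompact_glFiniteIntegralLevel m K), 0 < m → ∀ (π : Literature.NumberTheory.Automorphic.CuspidalAutomorphicRepData m K hcpt), π.1.IsLAlgebraic → ∀ (ℓ : ℕ) [Fact ℓ.Prime] (ι : PadicAlgCl ℓ ≃+* ℂ) (ρ : Literature.NumberTheory.GaloisRepresentations.FramedGaloisRep K (PadicAlgCl ℓ) m), ρ.toGaloisRep.IsSemisimple → (∀ᶠ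 v : IsDedekindDomain.HeightOneSpectrum (NumberField.RingOfIntegers K) in cofinite, SatakeFrobCompatibleAt ι π.1 ρ v) → ρ.toGaloisRep.IsIrreducible) → ∀ (ℓ : ℕ) [Fact ℓ.Prime] (ι : PadicAlgCl ℓ ≃+* ℂ) (ρ : Literature.NumberTheory.GaloisRepresentations.FramedGaloisRep K (PadicAlgCl ℓ) n), ρ.toGaloisRep.IsSemisimple → (∀ᶠ v : IsDedekindDomain.HeightOneSpectrum (NumberField.RingOfIntegers K) in cofinite, SatakeFrobCompatibleAt ι π.1 ρ v) → ¬ (∃ (L : Type) (_ : Field L) (_ : NumberField L) (_ : NumberField.IsCMField L) (hcptL : Literature.NumberTheory.Automorphic.isCompact_glFiniteIntegralLevel n L) (P : Literature.NumberTheory.Automorphic.CuspidalAutomorphicRepData n L hcptL), (∃ T : Literature.NumberTheory.Automorphic.InfinityType L n, P.1.HasInfinityType T ∧ T.IsLAlgebraic ∧ T.IsRegular) ∧ (∃ (χ : Literature.NumberTheory.GaloisRepresentations.HeckeCharacter L) (m : ℤ), (∀ x : Literature.NumberTheory.GaloisRepresentations.ideleGroup L, ((χ x : ℂˣ) : ℂ)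 = (Literature.NumberTheory.GaloisRepresentations.ideleNorm x : ℂ) ^ (m : ℂ)) ∧ P.1.IsEssConjSelfDual χ) ∧ ∃ ρP : Literature.NumberTheory.GaloisRepresentations.FramedGaloisRep L (PadicAlgCl ℓ) n, ρP.toGaloisRep.IsSemisimple ∧ (∀ᶠ u : IsDedekindDomain.HeightOneSpectrum (NumberField.RingOfIntegers L) in cofinite, SatakeFrobCompatibleAt ι P.1 ρP u) ∧ ∃ (M : Type) (_ : Field M) (_ : NumberField M) (_ : Algebra K M) (_ : Algebra L M) (η : ContinuousMonoidHom (Field.absoluteGaloisGroup M) (PadicAlgCl ℓ)ˣ), IsConjugate (ρ.restrictField M) ((ρP.restrictField M).twist η)) → (∃ (L : Type) (_ : Field L) (_ : NumberField L) (_ : NumberField.IsCMField L) (hcptL : Literature.NumberTheory.Automorphic.isCompact_glFiniteIntegralLevel n L) (P : Literature.NumberTheory.Automorphic.CuspidalAutomorphicRepData n L hcptL), (∃ T : Literature.NumberTheory.Automorphic.InfinityType L n, P.1.HasInfinityType T ∧ T.IsLAlgebraic ∧ T.IsRegular) ∧ (∃ (v : IsDedekindDomain.HeightOneSpectrum (NumberField.RingOfIntegers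 L)) (πv : Literature.NumberTheory.Automorphic.SmoothIrrep (Matrix.GeneralLinearGroup (Fin n) (v.adicCompletion L))), P.1.HasLocalComponentAt v πv.ρ ∧ (∀ [MeasurableSpace (Matrix.GeneralLinearGroup (Fin n) (v.adicCompletion L) ⧸ Subgroup.center (Matrix.GeneralLinearGroup (Fin n) (v.adicCompletion L)))] [BorelSpace (Matrix.GeneralLinearGroup (Fin n) (v.adicCompletion L) ⧸ Subgroup.center (Matrix.GeneralLinearGroup (Fin n) (v.adicCompletion L)))] (μ : MeasureTheory.Measure (Matrix.GeneralLinearGroup (Fin n) (v.adicCompletion L) ⧸ Subgroup.center (Matrix.GeneralLinearGroup (Fin n) (v.adicCompletion L)))) [μ.IsHaarMeasure], πv.ρ.IsEssentiallyDiscreteSeries μ) ∧ ∃ χ : Matrix.GeneralLinearGroup (Fin n) (v.adicCompletion L) →* ℂˣ, IsOpen (χ.ker : Set (Matrix.GeneralLinearGroup (Fin n) (v.adicCompletion L))) ∧ ∃ w : πv.V, w ≠ 0 ∧ ∀ g ∈ Literature.NumberTheory.Automorphic.iwahoriGL n (v.adicCompletion L), (πv.ρ.twist χ) g w = w) ∧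 ∃ ρP : Literature.NumberTheory.GaloisRepresentations.FramedGaloisRep L (PadicAlgCl ℓ) n, ρP.toGaloisRep.IsSemisimple ∧ (∀ᶠ u : IsDedekindDomain.HeightOneSpectrum (NumberField.RingOfIntegers L) in cofinite, SatakeFrobCompatibleAt ι P.1 ρP u) ∧ ∃ (M : Type) (_ : Field M) (_ : NumberField M) (_ : Algebra K M) (_ : Algebra L M) (η : ContinuousMonoidHom (Field.absoluteGaloisGroup M) (PadicAlgCl ℓ)ˣ), IsConjugate (ρ.restrictField M) ((ρP.restrictField M).twist η)) → ρ.toGaloisRep.IsIrreducible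

-- parent: CuspidalAvatarIrreducible · child (gen 1)
/--     item stmt-Langlands-33112 · crux · rank 703 · open
    parent: CuspidalAvatarIrreducible · by planner
    why it might fail: Only with Irr: a reducible semisimple Satake-compatible ρ for a Steinberg-type cuspidal π over a non-CM-reachable field or of irregular weight; no construction, no big-image input and no LGC is available there (Shimura-variety realization / non-regular weight barriers).
    sources: Scholze2015, HarrisLanTaylorThorneRMS2016, BuzzardGeeLMS2014, CalegariGee2013, TaylorYoshida2007, VarmaFMS2024
[crux] (RMD-cell = critic row 99 F1 «DARK»; child of CuspidalAvatarIrreducible = Irr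
stmt-Langlands-23601, open sector of the g7 RM-cell 31314; lens-2-g9 node ShadowDepthTrichotomy;
tags WEAKER · IDEA-NEEDED (dark: no construction; `ShimuraVarietyRealizationBarrier` /
`NonRegularWeightBarrier` territory); layer 2) Irr for the cuspidal L-algebraic π WITH a
regular-monodromy place (inlined RM(π): ∃ finite v, π_v ≃ St_n ⊗ χ — essentially discrete series
with an Iwahori-fixed vector after a twist; the g7 dial of 31314, VERBATIM), GIVEN Irr at every rank
m < n over every number field (rank IH VERBATIM as in 31315, see ORBIT (2)), for the semisimple
Satake-compatible ρ with NEITHER a polarized NOR a Steinberg regular CM shadow (inlined ¬PSH(ρ) ∧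
¬SRS(ρ): ∃ CM field L, ∃ regular L-algebraic cuspidal P on GL_n/L ‹of the class›, ∃ semisimple
cofinitely-Satake-compatible avatar ρP of P, ∃ number field M ⊇ K, L, ∃ continuous η : Γ_M → ℚ̄_ℓˣ
with ρ|Γ_M conjugate to (ρP|Γ_M) ⊗ η; classes: PSH = P norm-polarized (∃ m, P.1.IsEssConjSelfDual
‖·‖^m), SRS = P with a regular-monodromy place, RS = any; PSH ⟹ RS ⟸ SRS; g8's SSH ⟹ PSH ∧ SRS;
exact text = the statement / node defs). ORBIT-CLOSED BY CONST -/
@[route_item "route-Langlands-RetentionCarving"]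
def RegularMonodromyNoSteinbergShadowIrreducible : Prop :=
  ∀ (K : Type) [Field K] [NumberField K] (n : ℕ) (hcpt : Literature.NumberTheory.Automorphic.isCompact_glFiniteIntegralLevel n K), 0 < n → ∀ (π : Literature.NumberTheory.Automorphic.CuspidalAutomorphicRepData n K hcpt), π.1.IsLAlgebraic → (∃ (v : IsDedekindDomain.HeightOneSpectrum (NumberField.RingOfIntegers K)) (πv : Literature.NumberTheory.Automorphic.SmoothIrrep (Matrix.GeneralLinearGroup (Fin n) (v.adicCompletion K))), π.1.HasLocalComponentAt v πv.ρ ∧ (∀ [MeasurableSpace (Matrix.GeneralLinearGroup (Fin n) (v.adicCompletion K) ⧸ Subgroup.center (Matrix.GeneralLinearGroup (Fin n) (v.adicCompletion K)))] [BorelSpace (Matrix.GeneralLinearGroup (Fin n) (v.adicCompletion K) ⧸ Subgroup.center (Matrix.GeneralLinearGroup (Fin n) (v.adicCompletion K)))] (μ : MeasureTheory.Measure (Matrix.GeneralLinearGroup (Fin n) (v.adicCompletion K) ⧸ Subgroup.center (Matrix.GeneralLinearGroup (Fin n) (v.adicCompletion K)))) [μ.IsHaarMeasure], πv.ρ.IsEssentiallyDiscreteSeries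 μ) ∧ ∃ χ : Matrix.GeneralLinearGroup (Fin n) (v.adicCompletion K) →* ℂˣ, IsOpen (χ.ker : Set (Matrix.GeneralLinearGroup (Fin n) (v.adicCompletion K))) ∧ ∃ w : πv.V, w ≠ 0 ∧ ∀ g ∈ Literature.NumberTheory.Automorphic.iwahoriGL n (v.adicCompletion K), (πv.ρ.twist χ) g w = w) → (∀ m : ℕ, m < n → ∀ (K : Type) [Field K] [NumberField K] (hcpt : Literature.NumberTheory.Automorphic.isCompact_glFiniteIntegralLevel m K), 0 < m → ∀ (π : Literature.NumberTheory.Automorphic.CuspidalAutomorphicRepData m K hcpt), π.1.IsLAlgebraic → ∀ (ℓ : ℕ) [Fact ℓ.Prime] (ι : PadicAlgCl ℓ ≃+* ℂ) (ρ : Literature.NumberTheory.GaloisRepresentations.FramedGaloisRep K (PadicAlgCl ℓ) m), ρ.toGaloisRep.IsSemisimple → (∀ᶠ v : IsDedekindDomain.HeightOneSpectrum (NumberField.RingOfIntegers K) in cofinite, SatakeFrobCompatibleAt ι π.1 ρ v) → ρ.toGaloisRep.IsIrreducible) → ∀ (ℓ : ℕ) [Fact ℓ.Prime] (ι : PadicAlgCl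 ℓ ≃+* ℂ) (ρ : Literature.NumberTheory.GaloisRepresentations.FramedGaloisRep K (PadicAlgCl ℓ) n), ρ.toGaloisRep.IsSemisimple → (∀ᶠ v : IsDedekindDomain.HeightOneSpectrum (NumberField.RingOfIntegers K) in cofinite, SatakeFrobCompatibleAt ι π.1 ρ v) → ¬ (∃ (L : Type) (_ : Field L) (_ : NumberField L) (_ : NumberField.IsCMField L) (hcptL : Literature.NumberTheory.Automorphic.isCompact_glFiniteIntegralLevel n L) (P : Literature.NumberTheory.Automorphic.CuspidalAutomorphicRepData n L hcptL), (∃ T : Literature.NumberTheory.Automorphic.InfinityType L n, P.1.HasInfinityType T ∧ T.IsLAlgebraic ∧ T.IsRegular) ∧ (∃ (χ : Literature.NumberTheory.GaloisRepresentations.HeckeCharacter L) (m : ℤ), (∀ x : Literature.NumberTheory.GaloisRepresentations.ideleGroup L, ((χ x : ℂˣ) : ℂ) = (Literature.NumberTheory.GaloisRepresentations.ideleNorm x : ℂ) ^ (m : ℂ)) ∧ P.1.IsEssConjSelfDual χ) ∧ ∃ ρP : Literature.NumberTheory.GaloisRepresentations.FramedGaloisRep L (PadicAlgCl ℓ) n,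 ρP.toGaloisRep.IsSemisimple ∧ (∀ᶠ u : IsDedekindDomain.HeightOneSpectrum (NumberField.RingOfIntegers L) in cofinite, SatakeFrobCompatibleAt ι P.1 ρP u) ∧ ∃ (M : Type) (_ : Field M) (_ : NumberField M) (_ : Algebra K M) (_ : Algebra L M) (η : ContinuousMonoidHom (Field.absoluteGaloisGroup M) (PadicAlgCl ℓ)ˣ), IsConjugate (ρ.restrictField M) ((ρP.restrictField M).twist η)) → ¬ (∃ (L : Type) (_ : Field L) (_ : NumberField L) (_ : NumberField.IsCMField L) (hcptL : Literature.NumberTheory.Automorphic.isCompact_glFiniteIntegralLevel n L) (P : Literature.NumberTheory.Automorphic.CuspidalAutomorphicRepData n L hcptL), (∃ T : Literature.NumberTheory.Automorphic.InfinityType L n, P.1.HasInfinityType T ∧ T.IsLAlgebraic ∧ T.IsRegular) ∧ (∃ (v : IsDedekindDomain.HeightOneSpectrum (NumberField.RingOfIntegers L)) (πv : Literature.NumberTheory.Automorphic.SmoothIrrep (Matrix.GeneralLinearGroup (Fin n) (v.adicCompletion L))), P.1.HasLocalComponentAt v πv.ρ ∧ (∀ [MeasurableSpace (Matrix.GeneralLinearGroup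 (Fin n) (v.adicCompletion L) ⧸ Subgroup.center (Matrix.GeneralLinearGroup (Fin n) (v.adicCompletion L)))] [BorelSpace (Matrix.GeneralLinearGroup (Fin n) (v.adicCompletion L) ⧸ Subgroup.center (Matrix.GeneralLinearGroup (Fin n) (v.adicCompletion L)))] (μ : MeasureTheory.Measure (Matrix.GeneralLinearGroup (Fin n) (v.adicCompletion L) ⧸ Subgroup.center (Matrix.GeneralLinearGroup (Fin n) (v.adicCompletion L)))) [μ.IsHaarMeasure], πv.ρ.IsEssentiallyDiscreteSeries μ) ∧ ∃ χ : Matrix.GeneralLinearGroup (Fin n) (v.adicCompletion L) →* ℂˣ, IsOpen (χ.ker : Set (Matrix.GeneralLinearGroup (Fin n) (v.adicCompletion L))) ∧ ∃ w : πv.V, w ≠ 0 ∧ ∀ g ∈ Literature.NumberTheory.Automorphic.iwahoriGL n (v.adicCompletion L), (πv.ρ.twist χ) g w = w) ∧ ∃ ρP : Literature.NumberTheory.GaloisRepresentations.FramedGaloisRep L (PadicAlgCl ℓ) n, ρP.toGaloisRep.IsSemisimple ∧ (∀ᶠ u : IsDedekindDomain.HeightOneSpectrum (NumberField.RingOfIntegers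 L) in cofinite, SatakeFrobCompatibleAt ι P.1 ρP u) ∧ ∃ (M : Type) (_ : Field M) (_ : NumberField M) (_ : Algebra K M) (_ : Algebra L M) (η : ContinuousMonoidHom (Field.absoluteGaloisGroup M) (PadicAlgCl ℓ)ˣ), IsConjugate (ρ.restrictField M) ((ρP.restrictField M).twist η)) → ρ.toGaloisRep.IsIrreducible

-- parent: CuspidalAvatarIrreducible · child (gen 1)
/--     item stmt-Langlands-33113 · crux · rank 704 · open
    parent: CuspidalAvatarIrreducible · by planner
    why it might fail: Only with Irr: for non-polarized regular π over CM fields irreducibility is open from n = 3 on (Böckle–Hui 2025 needs K totally real; Shavali 2026 needs n = 4, K TR); the summand engines need purity / de Rham inputs at ℓ = p not yet in print for HLTT–Scholze representations.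
    sources: BockleHui2025, Shavali2026GL4, ACCGHLNSTT2023, AHTW2026, VarmaFMS2024, HarrisLanTaylorThorneRMS2016
[crux] (UNP-cell, child of CuspidalAvatarIrreducible = Irr stmt-Langlands-23601, open sector of the
declared residual NRM 31315; lens-2-g9 node ShadowDepthTrichotomy; tags WEAKER ·
ATTACKABLE-BY-ENGINE; layer 2) Irr for the cuspidal L-algebraic π WITHOUT a regular-monodromy place
(inlined ¬RM(π): ∃ finite v, π_v ≃ St_n ⊗ χ — essentially discrete series with an Iwahori-fixed
vector after a twist; the g7 dial of 31314, VERBATIM), GIVEN Irr at every rank m < n over every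
number field (the strong-induction hypothesis, VERBATIM as in 31315), for the semisimple
Satake-compatible ρ WITHOUT a polarized regular CM shadow but WITH a regular CM shadow (inlined
¬PSH(ρ) ∧ RS(ρ): ∃ CM field L, ∃ regular L-algebraic cuspidal P on GL_n/L ‹of the class›, ∃
semisimple cofinitely-Satake-compatible avatar ρP of P, ∃ number field M ⊇ K, L, ∃ continuous η :
Γ_M → ℚ̄_ℓˣ with ρ|Γ_M conjugate to (ρP|Γ_M) ⊗ η; classes: PSH = P norm-polarized (∃ m,
P.1.IsEssConjSelfDual ‖·‖^m), SRS = P with a regular-monodromy place, RS = any; PSH ⟹ RS ⟸ SRS; g8's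
SSH ⟹ PSH ∧ SRS; exact text = the statement / node defs). ORBIT-CLOSED BY CONSTRUCTION (critic rows
6/74/83/99/105/109/114; cleared row 118): the ρ-dials are ∃(L,P -/
@[route_item "route-Langlands-RetentionCarving"]
def UnpolarizedRegularShadowIrreducible : Prop :=
  ∀ (K : Type) [Field K] [NumberField K] (n : ℕ) (hcpt : Literature.NumberTheory.Automorphic.isCompact_glFiniteIntegralLevel n K), 0 < n → ∀ (π : Literature.NumberTheory.Automorphic.CuspidalAutomorphicRepData n K hcpt), π.1.IsLAlgebraic → ¬ (∃ (v : IsDedekindDomain.HeightOneSpectrum (NumberField.RingOfIntegers K)) (πv : Literature.NumberTheory.Automorphic.SmoothIrrep (Matrix.GeneralLinearGroup (Fin n) (v.adicCompletion K))), π.1.HasLocalComponentAt v πv.ρ ∧ (∀ [MeasurableSpace (Matrix.GeneralLinearGroup (Fin n) (v.adicCompletion K) ⧸ Subgroup.center (Matrix.GeneralLinearGroup (Fin n) (v.adicCompletion K)))] [BorelSpace (Matrix.GeneralLinearGroup (Fin n) (v.adicCompletion K) ⧸ Subgroup.center (Matrix.GeneralLinearGroup (Fin n) (v.adicCompletion K)))]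 (μ : MeasureTheory.Measure (Matrix.GeneralLinearGroup (Fin n) (v.adicCompletion K) ⧸ Subgroup.center (Matrix.GeneralLinearGroup (Fin n) (v.adicCompletion K)))) [μ.IsHaarMeasure], πv.ρ.IsEssentiallyDiscreteSeries μ) ∧ ∃ χ : Matrix.GeneralLinearGroup (Fin n) (v.adicCompletion K) →* ℂˣ, IsOpen (χ.ker : Set (Matrix.GeneralLinearGroup (Fin n) (v.adicCompletion K))) ∧ ∃ w : πv.V, w ≠ 0 ∧ ∀ g ∈ Literature.NumberTheory.Automorphic.iwahoriGL n (v.adicCompletion K), (πv.ρ.twist χ) g w = w) → (∀ m : ℕ, m < n → ∀ (K : Type) [Field K] [NumberField K] (hcpt : Literature.NumberTheory.Automorphic.isCompact_glFiniteIntegralLevel m K), 0 < m → ∀ (π : Literature.NumberTheory.Automorphic.CuspidalAutomorphicRepData m K hcpt), π.1.IsLAlgebraic → ∀ (ℓ : ℕ) [Fact ℓ.Prime] (ι : PadicAlgCl ℓ ≃+* ℂ) (ρ : Literature.NumberTheory.GaloisRepresentations.FramedGaloisRep K (PadicAlgCl ℓ) m), ρ.toGaloisRep.IsSemisimple → (∀ᶠ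 v : IsDedekindDomain.HeightOneSpectrum (NumberField.RingOfIntegers K) in cofinite, SatakeFrobCompatibleAt ι π.1 ρ v) → ρ.toGaloisRep.IsIrreducible) → ∀ (ℓ : ℕ) [Fact ℓ.Prime] (ι : PadicAlgCl ℓ ≃+* ℂ) (ρ : Literature.NumberTheory.GaloisRepresentations.FramedGaloisRep K (PadicAlgCl ℓ) n), ρ.toGaloisRep.IsSemisimple → (∀ᶠ v : IsDedekindDomain.HeightOneSpectrum (NumberField.RingOfIntegers K) in cofinite, SatakeFrobCompatibleAt ι π.1 ρ v) → ¬ (∃ (L : Type) (_ : Field L) (_ : NumberField L) (_ : NumberField.IsCMField L) (hcptL : Literature.NumberTheory.Automorphic.isCompact_glFiniteIntegralLevel n L) (P : Literature.NumberTheory.Automorphic.CuspidalAutomorphicRepData n L hcptL), (∃ T : Literature.NumberTheory.Automorphic.InfinityType L n, P.1.HasInfinityType T ∧ T.IsLAlgebraic ∧ T.IsRegular) ∧ (∃ (χ : Literature.NumberTheory.GaloisRepresentations.HeckeCharacter L) (m : ℤ), (∀ x : Literature.NumberTheory.GaloisRepresentations.ideleGroup L, ((χ x : ℂˣ) : ℂ)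 = (Literature.NumberTheory.GaloisRepresentations.ideleNorm x : ℂ) ^ (m : ℂ)) ∧ P.1.IsEssConjSelfDual χ) ∧ ∃ ρP : Literature.NumberTheory.GaloisRepresentations.FramedGaloisRep L (PadicAlgCl ℓ) n, ρP.toGaloisRep.IsSemisimple ∧ (∀ᶠ u : IsDedekindDomain.HeightOneSpectrum (NumberField.RingOfIntegers L) in cofinite, SatakeFrobCompatibleAt ι P.1 ρP u) ∧ ∃ (M : Type) (_ : Field M) (_ : NumberField M) (_ : Algebra K M) (_ : Algebra L M) (η : ContinuousMonoidHom (Field.absoluteGaloisGroup M) (PadicAlgCl ℓ)ˣ), IsConjugate (ρ.restrictField M) ((ρP.restrictField M).twist η)) → (∃ (L : Type) (_ : Field L) (_ : NumberField L) (_ : NumberField.IsCMField L) (hcptL : Literature.NumberTheory.Automorphic.isCompact_glFiniteIntegralLevel n L) (P : Literature.NumberTheory.Automorphic.CuspidalAutomorphicRepData n L hcptL), (∃ T : Literature.NumberTheory.Automorphic.InfinityType L n, P.1.HasInfinityType T ∧ T.IsLAlgebraic ∧ T.IsRegular) ∧ ∃ ρP : Literature.NumberTheory.GaloisRepresentations.FramedGaloisRep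 L (PadicAlgCl ℓ) n, ρP.toGaloisRep.IsSemisimple ∧ (∀ᶠ u : IsDedekindDomain.HeightOneSpectrum (NumberField.RingOfIntegers L) in cofinite, SatakeFrobCompatibleAt ι P.1 ρP u) ∧ ∃ (M : Type) (_ : Field M) (_ : NumberField M) (_ : Algebra K M) (_ : Algebra L M) (η : ContinuousMonoidHom (Field.absoluteGaloisGroup M) (PadicAlgCl ℓ)ˣ), IsConjugate (ρ.restrictField M) ((ρP.restrictField M).twist η)) → ρ.toGaloisRep.IsIrreducible

-- parent: CuspidalAvatarIrreducible · child (gen 1)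
/--     item stmt-Langlands-33114 · crux · rank 705 · open
    parent: CuspidalAvatarIrreducible · by planner
    why it might fail: Only with Irr: for irregular cuspidal π (Maass forms, weight-one type in rank ≥ 3) or regular π over non-CM-reachable fields nothing is known beyond n ≤ 2 special cases; no construction, no purity, no LGC (non-regular weight / Shimura-realization barriers).
    sources: BuzzardGeeLMS2014, CalegariGeraghty2018, DeligneSerre1974, Scholze2015, HarrisLanTaylorThorneRMS2016, CalegariGee2013
[crux] (NRD-cell = the lineage's DECLARED RESIDUAL after g9 — strictly below NRM 31315; child of
CuspidalAvatarIrreducible = Irr stmt-Langlands-23601; lens-2-g9 node ShadowDepthTrichotomy; tags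
WEAKER · IDEA-NEEDED (dark: irregular π / non-CM-reachable K — `NonRegularWeightBarrier`,
`ShimuraVarietyRealizationBarrier`) · DECLARED RESIDUAL; layer 2) Irr for the cuspidal L-algebraic π
WITHOUT a regular-monodromy place (inlined ¬RM(π): ∃ finite v, π_v ≃ St_n ⊗ χ — essentially discrete
series with an Iwahori-fixed vector after a twist; the g7 dial of 31314, VERBATIM), GIVEN Irr at
every rank m < n over every number field (VERBATIM as in 31315), for the semisimple
Satake-compatible ρ with NO regular CM shadow at all (inlined ¬RS(ρ): ∃ CM field L, ∃ regular
L-algebraic cuspidal P on GL_n/L ‹of the class›, ∃ semisimple cofinitely-Satake-compatible avatar ρP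
of P, ∃ number field M ⊇ K, L, ∃ continuous η : Γ_M → ℚ̄_ℓˣ with ρ|Γ_M conjugate to (ρP|Γ_M) ⊗ η;
classes: PSH = P norm-polarized (∃ m, P.1.IsEssConjSelfDual ‖·‖^m), SRS = P with a regular-monodromy
place, RS = any; PSH ⟹ RS ⟸ SRS; g8's SSH ⟹ PSH ∧ SRS; exact text = the statement / node defs).
ORBIT-CLOSED BY CONSTRUCTION (critic rows 6 -/
@[route_item "route-Langlands-RetentionCarving"]
def ShadowlessGenericIrreducible : Prop :=
  ∀ (K : Type) [Field K] [NumberField K] (n : ℕ) (hcpt : Literature.NumberTheory.Automorphic.isCompact_glFiniteIntegralLevel n K), 0 < n → ∀ (π : Literature.NumberTheory.Automorphic.CuspidalAutomorphicRepData n K hcpt), π.1.IsLAlgebraic → ¬ (∃ (v : IsDedekindDomain.HeightOneSpectrum (NumberField.RingOfIntegers K)) (πv : Literature.NumberTheory.Automorphic.SmoothIrrep (Matrix.GeneralLinearGroup (Fin n) (v.adicCompletion K))), π.1.HasLocalComponentAt v πv.ρ ∧ (∀ [MeasurableSpace (Matrix.GeneralLinearGroup (Fin n) (v.adicCompletion K)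 ⧸ Subgroup.center (Matrix.GeneralLinearGroup (Fin n) (v.adicCompletion K)))] [BorelSpace (Matrix.GeneralLinearGroup (Fin n) (v.adicCompletion K) ⧸ Subgroup.center (Matrix.GeneralLinearGroup (Fin n) (v.adicCompletion K)))] (μ : MeasureTheory.Measure (Matrix.GeneralLinearGroup (Fin n) (v.adicCompletion K) ⧸ Subgroup.center (Matrix.GeneralLinearGroup (Fin n) (v.adicCompletion K)))) [μ.IsHaarMeasure], πv.ρ.IsEssentiallyDiscreteSeries μ) ∧ ∃ χ : Matrix.GeneralLinearGroup (Fin n) (v.adicCompletion K) →* ℂˣ, IsOpen (χ.ker : Set (Matrix.GeneralLinearGroup (Fin n) (v.adicCompletion K))) ∧ ∃ w : πv.V, w ≠ 0 ∧ ∀ g ∈ Literature.NumberTheory.Automorphic.iwahoriGL n (v.adicCompletion K), (πv.ρ.twist χ) g w = w) → (∀ m : ℕ, m < n → ∀ (K : Type) [Field K] [NumberField K] (hcpt : Literature.NumberTheory.Automorphic.isCompact_glFiniteIntegralLevel m K), 0 < m → ∀ (π : Literature.NumberTheory.Automorphic.CuspidalAutomorphicRepData m K hcpt), π.1.IsLAlgebraic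 → ∀ (ℓ : ℕ) [Fact ℓ.Prime] (ι : PadicAlgCl ℓ ≃+* ℂ) (ρ : Literature.NumberTheory.GaloisRepresentations.FramedGaloisRep K (PadicAlgCl ℓ) m), ρ.toGaloisRep.IsSemisimple → (∀ᶠ v : IsDedekindDomain.HeightOneSpectrum (NumberField.RingOfIntegers K) in cofinite, SatakeFrobCompatibleAt ι π.1 ρ v) → ρ.toGaloisRep.IsIrreducible) → ∀ (ℓ : ℕ) [Fact ℓ.Prime] (ι : PadicAlgCl ℓ ≃+* ℂ) (ρ : Literature.NumberTheory.GaloisRepresentations.FramedGaloisRep K (PadicAlgCl ℓ) n), ρ.toGaloisRep.IsSemisimple → (∀ᶠ v : IsDedekindDomain.HeightOneSpectrum (NumberField.RingOfIntegers K) in cofinite, SatakeFrobCompatibleAt ι π.1 ρ v) → ¬ (∃ (L : Type) (_ : Field L) (_ : NumberField L) (_ : NumberField.IsCMField L) (hcptL : Literature.NumberTheory.Automorphic.isCompact_glFiniteIntegralLevel n L) (P : Literature.NumberTheory.Automorphic.CuspidalAutomorphicRepData n L hcptL), (∃ T : Literature.NumberTheory.Automorphic.InfinityType L n, P.1.HasInfinityType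 T ∧ T.IsLAlgebraic ∧ T.IsRegular) ∧ ∃ ρP : Literature.NumberTheory.GaloisRepresentations.FramedGaloisRep L (PadicAlgCl ℓ) n, ρP.toGaloisRep.IsSemisimple ∧ (∀ᶠ u : IsDedekindDomain.HeightOneSpectrum (NumberField.RingOfIntegers L) in cofinite, SatakeFrobCompatibleAt ι P.1 ρP u) ∧ ∃ (M : Type) (_ : Field M) (_ : NumberField M) (_ : Algebra K M) (_ : Algebra L M) (η : ContinuousMonoidHom (Field.absoluteGaloisGroup M) (PadicAlgCl ℓ)ˣ), IsConjugate (ρ.restrictField M) ((ρP.restrictField M).twist η)) → ρ.toGaloisRep.IsIrreducible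

-- parent: CuspidalAvatarIrreducible · glue (gen 1)
/--     item stmt-Langlands-33115 · support · rank 706 · closed · proved by Summit.Langlands.Langlands.Theorems.RetentionCarving_CuspidalAvatarIrreducible_of_split_proof (prover)
    parent: CuspidalAvatarIrreducible · GLUE: children ⟹ parent · by planner
PolarizedShadowIrreducible → UnpolarizedSteinbergShadowIrreducible →
RegularMonodromyNoSteinbergShadowIrreducible → UnpolarizedRegularShadowIrreducible →
ShadowlessGenericIrreducible → CuspidalAvatarIrreducible — pure logic: ONE strong induction on the
rank n (every child carries «Irr at every rank < n over every number field» inlined, verbatim as in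
RootDecomp1.NoRegularMonodromyIrreducible) plus excluded middles on the inlined dials PSH(ρ) («ρ is
potentially, up to an ℓ-adic character, the avatar of a regular L-algebraic norm-polarized cuspidal
P over a CM field»), RM(π) («π has a regular-monodromy place», the g7 dial verbatim), SRS(ρ) («… P
with a regular-monodromy place») and RS(ρ) («… any regular P»); every child is
CuspidalAvatarIrreducible with its hypotheses verbatim plus dial literals and the IH;
decomp-langlands lens-2 g9 node kernel CuspidalAvatarIrreducible_of_split5, certified as
RetentionCarving_CuspidalAvatarIrreducible_of_split_proof
(nodes/lens-2-g9-ShadowDepthTrichotomy.kit_check_rc.lean rc 0 · 0 sorry · axioms standard) -/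
@[route_item "route-Langlands-RetentionCarving"]
def CuspidalAvatarIrreducible_of_split : Prop :=
  PolarizedShadowIrreducible → UnpolarizedSteinbergShadowIrreducible → RegularMonodromyNoSteinbergShadowIrreducible → UnpolarizedRegularShadowIrreducible → ShadowlessGenericIrreducible → CuspidalAvatarIrreducible

-- `CuspidalAvatarIrreducible_of_split` holds: proved by `Summit.Langlands.Langlands.Theorems.RetentionCarving_CuspidalAvatarIrreducible_of_split_proof` (its module imports this route file, so no `_holds` link can be stated here).

/-- item stmt-Langlands-17415 · aside · rank 9 · open · by planner
sources: BuzzardGeeLMS2014, HarrisLanTaylorThorneRMS2016, Scholze2015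
[crux] W⁺ — for every number field K, n ≥ 1, every L-algebraic cuspidal π of GL_n(𝔸_K) and every (ℓ,
ι) there is an IRREDUCIBLE ρ : Γ_K → GL_n(ℚ̄_ℓ) Satake–Frobenius compatible with (π, ι) at almost
all places (Buzzard–Gee Conj. 3.2.2 weak form + Ramakrishnan's cuspidal ⇒ irreducible; Clozel's
Conj. 1.1.1 in arXiv:2607.11763). No de Rham clause, no Rec: ε-free and Rec-free. [difficulty:
open-problem] -/
@[route_item "route-Langlands-RetentionCarving"]
def SatakeAvatarExistence : Prop :=
  ∀ (K : Type) [Field K] [NumberField K] (n : ℕ) (hcpt : Literature.NumberTheory.Automorphic.isCompact_glFiniteIntegralLevel n K), 0 < n → ∀ (π : Literature.NumberTheory.Automorphic.CuspidalAutomorphicRepData n K hcpt), π.1.IsLAlgebraic → ∀ (ℓ : ℕ) [Fact ℓ.Prime] (ι : PadicAlgCl ℓ ≃+* ℂ), ∃ ρ : Literature.NumberTheory.GaloisRepresentations.FramedGaloisRep K (PadicAlgCl ℓ) n, ρ.toGaloisRep.IsIrreducible ∧ ∀ᶠ v : IsDedekindDomain.HeightOneSpectrum (NumberField.RingOfIntegers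 K) in cofinite, SatakeFrobCompatibleAt ι π.1 ρ v

/-- item stmt-Langlands-17930 · support · rank 9 · open · by planner
sources: HarrisTaylorAMS2001, HenniartInventiones2000, Deligne1973Constantes
[support] THE SUMMIT'S NON-VACUITY CONJUNCT, verbatim (statement revision p141787, 2026-08-17:
`Langlands := ∀ F, Nonempty (ReciprocityData F) ∧ ∀ 𝓡 n, 0 < n → ∀ hcpt, GLC n F 𝓡 hcpt`, with
`ReciprocityData` pinned to THE local Artin maps by `llc_isCanonical` / `llc_eps_isCanonical`),
filed by route-repair 5a1bd9af as the explicit INPUT of this route's `∃ RD`-shaped slices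
(LiftB2Unram, LiftB2UnramSmallF, LiftB2UnramLargeF, LiftB2UnramSplitP): for every number field F and
every finite place v, a local Langlands datum for GL_n(F_v) (Harris–Taylor 2001 Thm A; Henniart 2000
Thm 1.2) normalised against THE local Artin map `canonicalArtin (F_v)`, whose ε-system (Deligne 1973
Thm 4.1) is normalised against the canonical Artin map of every finite E/F_v. IN PRINT,
textbook-grade input (Harris–Taylor's Thm A is stated relative to Art_K of local class field
theory); in the TREE not yet derivable — `LocalLanglandsDatum.nonempty` (cite-only) yields a datum
with SOME lawful Artin normalisation, and canonicity needs `IsLocalArtinMap.unique` + the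
finite-level reciprocity law for that datum's Artin maps, or canonical variants of
`localLanglands_gl` / `nonempty_localEpsilonSystem` (needs-fact for -/
@[route_item "route-Langlands-RetentionCarving", crux]
def CanonicalReciprocityData : Prop :=
  ∀ (F : Type) [Field F] [NumberField F], Nonempty (Summit.Langlands.ReciprocityData F)

/-- item stmt-Langlands-18084 · aside · rank 9 · open · by planner
sources: TaylorGaloisRepresentations2004, HarrisTaylorAMS2001, HenniartInventiones2000, VarmaFMS2024
[crux] L∤R — Taylor 2004 Conj. 7 at the places v ∤ ℓ, in the `∀ Rec` form (rev 4, lockstep re-type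
after the summit re-type p141787 `∀ F, Nonempty (ReciprocityData F) ∧ ∀ 𝓡 …`): for every number
field K and EVERY reciprocity datum Rec (Henniart-normalised local Langlands data with THE canonical
Artin pins — the summit's `∀ 𝓡`), every n ≥ 1 and hcpt, every L-algebraic cuspidal π of GL_n(𝔸_K),
every (ℓ, ι) and every IRREDUCIBLE ρ : Γ_K → GL_n(ℚ̄_ℓ) that is pinned-geometric (unramified a.e.,
de Rham above ℓ for Fontaine's pinned datum) and Satake–Frobenius compatible with (π, ι) a.e.:
`LocalGlobalCompatibleAt Rec ι π ρ v` at every finite v ∤ ℓ (Grothendieck–Deligne Weil–Deligne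
representation, Frobenius-semisimplified, ↔ rec_v(π_v)). = item L∤ (stmt-Langlands-17417, ∃-Rec
form; verbatim the registered stub `stub_pairCompatibilityAway` of line `Sketch` of crux 14328) with
Rec moved from `∃ Rec,` to a universal binder after K and nothing else changed; the ∃-form is
implied back by L∤R ∧ CanonicalReciprocityData (`compatibilityAwayFromL_existsForm`).
Kernel-certified consequence of the re-typed summit (`compatibilityAwayFromLR_of_langlands`, planner
bc/SubsOfLanglandsR.lean: direction (A -/
@[route_item "route-Langlands-RetentionCarving"]
def CompatibilityAwayFromLR : Prop :=
  ∀ (K : Type) [Field K] [NumberField K] (Rec : ReciprocityData K) (n : ℕ) (hcpt : Literature.NumberTheory.Automorphic.isCompact_glFiniteIntegralLevel n K), 0 < n → ∀ (π : Literature.NumberTheory.Automorphic.CuspidalAutomorphicRepData n K hcpt), π.1.IsLAlgebraic → ∀ (ℓ : ℕ) [Fact ℓ.Prime] (ι : PadicAlgCl ℓ ≃+* ℂ) (ρ : Literature.NumberTheory.GaloisRepresentations.FramedGaloisRep K (PadicAlgCl ℓ) n), ρ.toGaloisRep.IsIrreducible → ((∀ᶠ v : IsDedekindDomain.HeightOneSpectrum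 (NumberField.RingOfIntegers K) in cofinite, ρ.IsUnramifiedAt v) ∧ ∀ (v : IsDedekindDomain.HeightOneSpectrum (NumberField.RingOfIntegers K)) (hv : ((ℓ : ℕ) : NumberField.RingOfIntegers K) ∈ v.asIdeal), (Literature.NumberTheory.PAdicHodge.fontainePstAdicCompletion v ℓ hv).IsDeRhamFramed (ρ.toLocal v)) → (∀ᶠ v : IsDedekindDomain.HeightOneSpectrum (NumberField.RingOfIntegers K) in cofinite, SatakeFrobCompatibleAt ι π.1 ρ v) → ∀ v : IsDedekindDomain.HeightOneSpectrum (NumberField.RingOfIntegers K), ((ℓ : ℕ) : NumberField.RingOfIntegers K) ∉ v.asIdeal → LocalGlobalCompatibleAt Rec ι π.1 ρ v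

/-- item stmt-Langlands-23602 · support · rank 9 · closed · proved by Summit.Langlands.Langlands.Theorems.SatakePlacesAllData_proof (prover) · by planner
sources: BuzzardGeeLMS2014, JacquetShalika1981, TateCorvallis1979
[support] [piece G of the L∤R split; verbatim the registered stub
`…CompatibilityAwayFromLR.Birth.stub_goodPlaces`; WEAKER (a theorem); leaf ATTACKABLE NOW — n ≥ 2:
landed
`Summit.Langlands.Langlands.Theorems.ReciprocityUpToIrreducibility.stub_rankN_localGlobalCompatibleAt_of_satakeFrobCompatibleAt`
/ `localGlobalCompatibleAt_away_of_isUnramifiedAt` (only the v ∤ ℓ branch is needed), n = 1: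
`rankOne_localGlobalCompatibleAt_of_satakeFrobCompatibleAt`; critic: CLEARED
decomp-langlands-crit-1-g0 0 2026-08-30T01:15:58Z (pub/decomp-langlands/STATUS.md; CRITIC-LEDGER.md
row 01:15:58Z)] at a Satake-compatible place v ∤ ℓ the summit's LocalGlobalCompatibleAt Rec ι π ρ v
holds for EVERY pinned datum Rec (unramified local Langlands = the Satake parameter; Buzzard–Gee
3.2.1 is Taylor's clause there). [difficulty: provable-now] -/
@[route_item "route-Langlands-RetentionCarving", crux]
def SatakePlacesAllData : Prop :=
  ∀ (K : Type) [Field K] [NumberField K] (Rec : ReciprocityData K) (n : ℕ) (hcpt : Literature.NumberTheory.Automorphic.isCompact_glFiniteIntegralLevel n K), 0 < n → ∀ (π : Literature.NumberTheory.Automorphic.CuspidalAutomorphicRepData n K hcpt) (ℓ : ℕ) [Fact ℓ.Prime] (ι : PadicAlgCl ℓ ≃+* ℂ) (ρ : Literature.NumberTheory.GaloisRepresentations.FramedGaloisRep K (PadicAlgCl ℓ) n) (v : IsDedekindDomain.HeightOneSpectrum (NumberField.RingOfIntegers K)), ((ℓ : ℕ) : NumberField.RingOfIntegers K) ∉ v.asIdeal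 → SatakeFrobCompatibleAt ι π.1 ρ v → LocalGlobalCompatibleAt Rec ι π.1 ρ v

/-- `SatakePlacesAllData` holds: proved by `Summit.Langlands.Langlands.Theorems.SatakePlacesAllData_proof`. -/
theorem SatakePlacesAllData_holds : SatakePlacesAllData := _root_.Summit.Langlands.Langlands.Theorems.SatakePlacesAllData_proof

/-- item stmt-Langlands-23603 · support · rank 9 · open · by planner
sources: HenniartBSMF2002, HarrisTaylorAMS2001, Shalika1974
[support] [piece R of the L∤R split; verbatim the registered stub
`…CompatibilityAwayFromLR.Birth.stub_recRigidity`; WEAKER (L∤R forces it: landed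
`Theorems/CompatibilityAwayFromLR/Negative/RigidOfCompatibilityAwayFromLR.lean`,
`recGL_eq_of_compatibilityAwayFromLR`); leaf ATTACKABLE closed-mod-print: conclusion of the landed
glue `ReciprocityUpToIrreducibilityR.stub_recRigidityLAlg_of_genericRigidity ∘
stub_genericRigidity_of_facts` from five local facts (localLanglands_gl, generic preimages, Henniart
2002 Thm 1.7(a) / 1.6(b), invariant measures); critic: CLEARED decomp-langlands-crit-1-g0 0
2026-08-30T01:15:58Z (pub/decomp-langlands/STATUS.md; CRITIC-LEDGER.md row 01:15:58Z)] any two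
pinned reciprocity data give the same class rec_v(π_v) to every local component of every L-algebraic
cuspidal π (Henniart's uniqueness of rec_v on generic classes; local components of cusp forms are
generic by Shalika). [difficulty: provable-now] -/
@[route_item "route-Langlands-RetentionCarving", crux]
def RecRigidity : Prop :=
  ∀ (K : Type) [Field K] [NumberField K] (Rec Rec' : ReciprocityData K) (n : ℕ) (hcpt : Literature.NumberTheory.Automorphic.isCompact_glFiniteIntegralLevel n K), 0 < n → ∀ (π : Literature.NumberTheory.Automorphic.CuspidalAutomorphicRepData n K hcpt), π.1.IsLAlgebraic → ∀ (v : IsDedekindDomain.HeightOneSpectrum (NumberField.RingOfIntegers K)) (πv : Literature.NumberTheory.Automorphic.SmoothIrrep (Matrix.GeneralLinearGroup (Fin n) (v.adicCompletion K))), π.1.HasLocalComponentAt v πv.ρ → (Rec.llc v).recGL n (Literature.NumberTheory.Automorphic.IrrClass.mk πv) = (Rec'.llc v).recGL n (Literature.NumberTheory.Automorphic.IrrClass.mk πv)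

/-- item stmt-Langlands-2374 · support · rank 9 · closed · proved by Summit.Langlands.Langlands.Theorems.GenericWDUnique_proof (prover) · by planner
why it might fail: it does not (theorem: Brauer–Nesbitt + AHTW 2026 Prop 6.0.5, the latter proved in tree); the Lean work is Brauer–Nesbitt for W_F-representations with finite image on inertia
sources: arXiv:2607.11763, Allen2016, Tate1979
[support] over an algebraically closed field of characteristic 0, two Frobenius-semisimple GENERIC
Weil–Deligne representations of W_F on the same space with equal traces of ρ(w) for all w are
isomorphic (ρ ≅ ρ' by Brauer–Nesbitt + "Φ-semisimple ⇒ semisimple"; generic ⇔ N in the open orbit of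
the centraliser on {N}; the open orbit is unique). This is the lemma turning X + Varma's semisimple
compatibility into the summit's v ∤ ℓ clause; pure algebra, provable now. [difficulty: provable-now] -/
@[route_item "route-Langlands-RetentionCarving", crux]
def GenericWDUnique : Prop :=
  ∀ (F : Type) [Field F] [ValuativeRel F] [TopologicalSpace F] [IsNonarchimedeanLocalField F] (E : Type) [Field E] [IsAlgClosed E] [CharZero E] (n : ℕ) (W W' : Literature.NumberTheory.GaloisRepresentations.WeilDeligneRep F E (Fin n → E)), W.IsFrobSemisimple → W'.IsFrobSemisimple → (∀ w : Literature.NumberTheory.GaloisRepresentations.WeilGroup F, LinearMap.trace E (Fin n → E) (W.ρ w) = LinearMap.trace E (Fin n → E) (W'.ρ w)) → (∀ f : (Fin n → E) →ₗ[E] (Fin n → E), (∀ w : Literature.NumberTheory.GaloisRepresentations.WeilGroup F, f ∘ₗ W.ρ w = ((Literature.NumberTheory.GaloisRepresentations.IsNonarchimedeanLocalField.residueFieldCard F : E) ^ (Literature.NumberTheory.GaloisRepresentations.WeilGroup.deg w)) • (W.ρ w ∘ₗ f)) → f ∘ₗ W.N = W.N ∘ₗ f → f = 0) → (∀ f : (Fin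 n → E) →ₗ[E] (Fin n → E), (∀ w : Literature.NumberTheory.GaloisRepresentations.WeilGroup F, f ∘ₗ W'.ρ w = ((Literature.NumberTheory.GaloisRepresentations.IsNonarchimedeanLocalField.residueFieldCard F : E) ^ (Literature.NumberTheory.GaloisRepresentations.WeilGroup.deg w)) • (W'.ρ w ∘ₗ f)) → f ∘ₗ W'.N = W'.N ∘ₗ f → f = 0) → W.IsEquivalent W'

/-- `GenericWDUnique` holds: proved by `Summit.Langlands.Langlands.Theorems.GenericWDUnique_proof`. -/
theorem GenericWDUnique_holds : GenericWDUnique := _root_.Summit.Langlands.Langlands.Theorems.GenericWDUnique_proof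

/-- item stmt-Langlands-25108 · support · rank 9 · open · by planner
why it might fail: only via the datum axioms: a pinned LocalLanglandsDatum differing from Harris–Taylor rec on a generic class (Henniart-sharpness of axioms (h1)–(h5)) would break the transfer — same exposure as RecRigidity 23603
sources: Shalika1974, Allen2016, arXiv:2607.11763, Henniart1993, HarrisTaylor2001
RECGEN — for every reciprocity datum Rec on K, every n ≥ 1, every L-algebraic cuspidal π of GL_n/K
and every finite place v with local component π_v: every Frobenius-semisimple member S of the class
rec_v(π_v) = (Rec.llc v).recGL n [π_v] is generic. Closed modulo print: π_v is generic (Shalika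
1974, global genericity of cusp forms on GL_n) and rec_v of a generic irreducible representation has
generic (F-semisimple) Weil–Deligne parameter (Allen 2016 Lemma 1.1.3 / AHTW 2026 §6, via
Bernstein–Zelevinsky), transported to any pinned datum by Henniart's uniqueness. TAGS (lens-6
MonodromyCarving v2; crit-1 CLEARED rows 9/12): NEW support · closed-mod-print (Shalika 1974; Allen
2016 L.1.1.3 / AHTW 2026 §6; Henniart uniqueness) · WEAKER · the print half of the algebraic seam
GEN ∧ RECGEN ∧ WDU ⟹ N. -/
@[route_item "route-Langlands-RetentionCarving", crux]
def RecPreservesGenericity : Prop :=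
  ∀ (K : Type) [Field K] [NumberField K] (Rec : ReciprocityData K) (n : ℕ) (hcpt : Literature.NumberTheory.Automorphic.isCompact_glFiniteIntegralLevel n K), 0 < n → ∀ (π : Literature.NumberTheory.Automorphic.CuspidalAutomorphicRepData n K hcpt), π.1.IsLAlgebraic → ∀ (v : IsDedekindDomain.HeightOneSpectrum (NumberField.RingOfIntegers K)) (πv : Literature.NumberTheory.Automorphic.SmoothIrrep (Matrix.GeneralLinearGroup (Fin n) (v.adicCompletion K))), π.1.HasLocalComponentAt v πv.ρ → ∀ (S : Literature.NumberTheory.GaloisRepresentations.WeilDeligneRep (v.adicCompletion K) ℂ (Fin n → ℂ)) (hS : S.IsFrobSemisimple), Quotient.mk (Literature.NumberTheory.Automorphic.frobSemisimpleWDSetoid (v.adicCompletion K) n) ⟨S, hS⟩ = (Rec.llc v).recGL n (Literature.NumberTheory.Automorphic.IrrClass.mk πv) → ∀ f : (Fin n → ℂ) →ₗ[ℂ] (Fin n → ℂ), (∀ w : Literature.NumberTheory.GaloisRepresentations.WeilGroup (v.adicCompletion K), f ∘ₗ S.ρ w = ((Literature.NumberTheory.GaloisRepresentations.IsNonarchimedeanLocalField.residueFieldCard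 (v.adicCompletion K) : ℂ) ^ (Literature.NumberTheory.GaloisRepresentations.WeilGroup.deg w)) • (S.ρ w ∘ₗ f)) → f ∘ₗ S.N = S.N ∘ₗ f → f = 0

/-- item stmt-Langlands-27962 · support · rank 9 · closed · proved by Summit.Langlands.Langlands.Theorems.MonodromyFreeRigidity_proof (prover) · by planner
sources: arXiv:2607.11763, TateCorvallis1979, DeligneAntwerpII1973, Allen2016
[support] [NEW · MFR, the U-LOCUS local algebra of the carving; PROVABLE NOW: it is Brauer–Nesbitt
for Frobenius-semisimple complex Weil–Deligne representations (tree theorem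
`WeilDeligneRep.nonempty_equiv_of_isFrobSemisimple_of_trace_eq`, WeilDeligneSemisimpleTraces.lean)
composed with the generic-orbit theorem A'Campo–Hevesi–Thorne–Whitmore 2026 Prop 6.0.5 (tree theorem
`WeilDeligneRep.AHTW2026_prop_6_0_5_generic_conj_holds`, GenericWeilDeligneOrbitProofs.lean); the
composition is KERNEL-CHECKED in nodes/lens-6-g3-RetentionCarving.lean
`MFRProof.monodromyFreeRigidity_of` and in the birth skeleton bc/MonodromyFreeRigidity_birth.lean (2
named stubs = the 2 tree theorems, rc 0, sorries = stubs); an item only because both modules are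
outside the farm build of 2026-08-30] The U-locus analogue of GenericWDUnique (2374): a
Frobenius-semisimple complex Weil–Deligne representation W of W_F on ℂⁿ with N = 0 which is generic
(no non-zero f with f ρ(w) = q^{deg w} ρ(w) f) is RIGID among Frobenius-semisimple Weil–Deligne
representations with the same traces: any such W′ has N = 0 and is isomorphic to W. TAGS
(decomp-langlands crit-1 CLEARED 2026-08-30T04:40:41Z (HOME/STATUS.md L181; HOME/CRIT -/
@[route_item "route-Langlands-RetentionCarving", crux]
def MonodromyFreeRigidity : Prop :=
  ∀ (F : Type) [Field F] [ValuativeRel F] [TopologicalSpace F] [IsNonarchimedeanLocalField F] (n : ℕ) (W W' : Literature.NumberTheory.GaloisRepresentations.WeilDeligneRep F ℂ (Fin n → ℂ)), W.IsFrobSemisimple → W'.IsFrobSemisimple → (∀ w : Literature.NumberTheory.GaloisRepresentations.WeilGroup F, LinearMap.trace ℂ (Fin n → ℂ) (W.ρ w) = LinearMap.trace ℂ (Fin n → ℂ) (W'.ρ w)) → W.N = 0 → (∀ f : (Fin n → ℂ) →ₗ[ℂ] (Fin n → ℂ), (∀ w : Literature.NumberTheory.GaloisRepresentations.WeilGroup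 F, f ∘ₗ W.ρ w = ((Literature.NumberTheory.GaloisRepresentations.IsNonarchimedeanLocalField.residueFieldCard F : ℂ) ^ (Literature.NumberTheory.GaloisRepresentations.WeilGroup.deg w)) • (W.ρ w ∘ₗ f)) → f ∘ₗ W.N = W.N ∘ₗ f → f = 0) → W'.N = 0 ∧ W.IsEquivalent W'

-- `MonodromyFreeRigidity` holds: proved by `Summit.Langlands.Langlands.Theorems.MonodromyFreeRigidity_proof` (its module imports this route file, so no `_holds` link can be stated here).

/-- item stmt-Langlands-27963 · assembly · rank 1 · closed · proved by Summit.Langlands.Langlands.Theorems.retentionCarving_assembly_proof (prover) · by planner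
sources: BuzzardGeeLMS2014, TaylorGaloisRepresentations2004, DeligneAntwerpII1973
[assembly] B_w → SemisimpleAvatar → CuspidalAvatarIrreducible → P → G → R → S → Ret → RECGEN → WDU →
MFR → CRD → Langlands (the curried form of `closes`, proved and applied inside it; W⁺, L∤R, N (by
cases on the monodromy type of the place) and GEN derived internally). -/
@[route_item "route-Langlands-RetentionCarving"]
def Assembly : Prop :=
  WeakGeometricAutomorphy → SemisimpleAvatar → CuspidalAvatarIrreducible → PadicMemberCompatibility → SatakePlacesAllData → RecRigidity → SemisimpleMatchingOneDatum → MonodromyRetention → RecPreservesGenericity → GenericWDUnique → MonodromyFreeRigidity → CanonicalReciprocityData → _root_.Langlands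

-- `Assembly` holds: proved by `Summit.Langlands.Langlands.Theorems.retentionCarving_assembly_proof` (its module imports this route file, so no `_holds` link can be stated here).

/-! D-0027 §2.1 — DECIDING THEOREM (planner-authored via `route open/edit --closes-file`; by planner-decomp-langlands-writer-1-g2-0 2026-08-30T04:41:55Z):
its hypotheses are this route's items and its conclusion the sub-problem Statement (glue_lint), and it elaborates with this file. -/

/- (spliced by the gate into the rendered route file via `--closes-file`; certify with
   `ledger route check --native route.json --closes-file glue.lean`)
   D-0027 §2.1 deciding theorem for route RetentionCarving (decomp-langlands lens-6 gen 3): byte-identical to the certified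
   glue of route-Langlands-RootDecomp1 rev 3 (nodes/writer-1-g0-RootDecomp1-rev3.glue.lean) except for the internal AND-node N,
   which is now derived BY CASES on the automorphic monodromy type of the place from Ret ∧ RECGEN ∧ WDU ∧ MFR (the node's
   `monodromyUpgrade_of_pieces`, nodes/lens-6-g3-RetentionCarving.lean) instead of from GEN ∧ RECGEN ∧ WDU. -/
@[closes "route-Langlands-RetentionCarving"] theorem closes (hB : WeakGeometricAutomorphy) (hSS : SemisimpleAvatar)
    (hIrr : CuspidalAvatarIrreducible) (hP : PadicMemberCompatibility) (hG : SatakePlacesAllData)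
    (hRig : RecRigidity) (hS : SemisimpleMatchingOneDatum) (hRet : MonodromyRetention)
    (hRG : RecPreservesGenericity) (hWDU : GenericWDUnique) (hMFR : MonodromyFreeRigidity)
    (hR : CanonicalReciprocityData) : _root_.Langlands := by
  -- `Assembly` (item) is literally the curried form of this theorem: prove it, then apply it.
  suffices hAsm : Assembly from hAsm hB hSS hIrr hP hG hRig hS hRet hRG hWDU hMFR hR
  clear hB hSS hIrr hP hG hRig hS hRet hRG hWDU hMFR hR
  intro hB hSS hIrr hP hG hRig hS hRet hRG hWDU hMFR hR
  -- internal AND-node W⁺ ⟸ SemisimpleAvatar ∧ CuspidalAvatarIrreducible (registered skeleton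
  -- Cruxes/SectorComplement/Lines/birth_SatakeAvatarExistence.lean, `SatakeAvatarExistence_of`; CLEARED crit-1 01:15:58Z)
  have hW : SatakeAvatarExistence := by
    intro K _ _ n hcpt hn π hL ℓ _ ι
    obtain ⟨ρ, hss, hρ⟩ := hSS K n hcpt hn π hL ℓ ι
    exact ⟨ρ, hIrr K n hcpt hn π hL ℓ ι ρ hss hρ, hρ⟩
  -- U = stmt-Langlands-17844, PROVED in the tree (Chebotarev + Brauer–Nesbitt; Deligne–Serre Lemme 3.2)
  have hU := @_root_.Summit.Langlands.Langlands.Theorems.EisensteinDegreeShiftSectorComplement.stub_avatarConjugacy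
  -- internal AND-node N ⟸ Ret ∧ RECGEN ∧ WDU ∧ MFR (lens-6 g3 RetentionCarving, kernel-checked in
  -- nodes/lens-6-g3-RetentionCarving.lean `monodromyUpgrade_of_pieces`, re-proved here over this route's decls):
  -- F-semisimplify the transported WD rep (traces unchanged: the nilpotent part is traceless); BY CASES on the automorphic
  -- monodromy type of the place: S.N = 0 — rec is generic (RECGEN) and monodromy-free, so MFR identifies r₁ with S (no phantom
  -- monodromy); S.N ≠ 0 — Ret makes r₁ generic, RECGEN makes S generic, WDU identifies them.
  have hN : ∀ (K : Type) [Field K] [NumberField K] (Rec : ReciprocityData K) (n : ℕ) (hcpt : Literature.NumberTheory.Automorphic.isCompact_glFiniteIntegralLevel n K), 0 < n → ∀ (π : Literature.NumberTheory.Automorphic.CuspidalAutomorphicRepData n K hcpt), π.1.IsLAlgebraic → ∀ (ℓ : ℕ) [Fact ℓ.Prime] (ι : PadicAlgCl ℓ ≃+* ℂ) (ρ : Literature.NumberTheory.GaloisRepresentations.FramedGaloisRep K (PadicAlgCl ℓ) n), ρ.toGaloisRep.IsIrreducible → ((∀ᶠ v : IsDedekindDomain.HeightOneSpectrum (NumberField.RingOfIntegers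 K) in cofinite, ρ.IsUnramifiedAt v) ∧ ∀ (v : IsDedekindDomain.HeightOneSpectrum (NumberField.RingOfIntegers K)) (hv : ((ℓ : ℕ) : NumberField.RingOfIntegers K) ∈ v.asIdeal), (Literature.NumberTheory.PAdicHodge.fontainePstAdicCompletion v ℓ hv).IsDeRhamFramed (ρ.toLocal v)) → (∀ᶠ v : IsDedekindDomain.HeightOneSpectrum (NumberField.RingOfIntegers K) in cofinite, SatakeFrobCompatibleAt ι π.1 ρ v) → ∀ v : IsDedekindDomain.HeightOneSpectrum (NumberField.RingOfIntegers K), ((ℓ : ℕ) : NumberField.RingOfIntegers K) ∉ v.asIdeal → ∀ (πv : Literature.NumberTheory.Automorphic.SmoothIrrep (Matrix.GeneralLinearGroup (Fin n) (v.adicCompletion K))), π.1.HasLocalComponentAt v πv.ρ → ∀ (W : Literature.NumberTheory.GaloisRepresentations.WeilDeligneRep (v.adicCompletion K) (PadicAlgCl ℓ) (Fin n → (PadicAlgCl ℓ))) (Wℂ : Literature.NumberTheory.GaloisRepresentations.WeilDeligneRep (v.adicCompletion K) ℂ (Fin n → ℂ)), Literature.NumberTheory.GaloisRepresentations.IsWeilDeligneOfLadic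 (ρ.toLocal v).toWeilGroupHom W → W.IsTransportAlong (ι : PadicAlgCl ℓ →+* ℂ) Wℂ → ∀ (S : Literature.NumberTheory.GaloisRepresentations.WeilDeligneRep (v.adicCompletion K) ℂ (Fin n → ℂ)) (hS : S.IsFrobSemisimple), Quotient.mk (Literature.NumberTheory.Automorphic.frobSemisimpleWDSetoid (v.adicCompletion K) n) ⟨S, hS⟩ = (Rec.llc v).recGL n (Literature.NumberTheory.Automorphic.IrrClass.mk πv) → (∀ w : Literature.NumberTheory.GaloisRepresentations.WeilGroup (v.adicCompletion K), LinearMap.trace ℂ (Fin n → ℂ) (Wℂ.ρ w) = LinearMap.trace ℂ (Fin n → ℂ) (S.ρ w)) → Wℂ.HasFrobSemisimpleClass ((Rec.llc v).recGL n (Literature.NumberTheory.Automorphic.IrrClass.mk πv)) := by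
    intro K _ _ Rec n hcpt hn π hL ℓ _ ι ρ hirr hgeo hsat v hv πv hπv W Wℂ hW hι S hS hcl htr
    obtain ⟨r₁, hr₁⟩ := Wℂ.exists_isFrobSemisimplificationOf
    have htr₁ : ∀ w : Literature.NumberTheory.GaloisRepresentations.WeilGroup (v.adicCompletion K),
        LinearMap.trace ℂ (Fin n → ℂ) (r₁.ρ w) = LinearMap.trace ℂ (Fin n → ℂ) (S.ρ w) := by
      intro w
      obtain ⟨m, hm, -, hw⟩ := (hr₁.2.2 w).2
      rw [← htr w, hw, map_add, (LinearMap.isNilpotent_trace_of_isNilpotent hm).eq_zero, add_zero]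
    have hgS := hRG K Rec n hcpt hn π hL v πv hπv S hS hcl
    have he : r₁.IsEquivalent S := by
      by_cases hN0 : S.N = 0
      · obtain ⟨-, ⟨e⟩⟩ :=
          hMFR (v.adicCompletion K) n S r₁ hS hr₁.isFrobSemisimple (fun w => (htr₁ w).symm) hN0 hgS
        exact ⟨e.symm⟩
      · have hg₁ := hRet K Rec n hcpt hn π hL ℓ ι ρ hirr hgeo hsat v hv πv hπv W Wℂ hW hι S hS hcl htr hN0 r₁ hr₁
        exact hWDU (v.adicCompletion K) ℂ n r₁ S hr₁.isFrobSemisimple hS htr₁ hg₁ hgS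
    refine ⟨r₁, hr₁, ?_⟩
    rw [← hcl]
    exact Quotient.sound he
  -- internal AND-node L∤R ⟸ G ∧ R ∧ S ∧ N (registered skeleton Cruxes/CompatibilityAwayFromLR/Lines/birth.lean,
  -- `CompatibilityAwayFromLR_of`, re-proved here over this route's decls)
  have hA : CompatibilityAwayFromLR := by
    intro K _ _ Rec n hcpt hn π hL ℓ _ ι ρ hirr hgeo hρ v hv
    by_cases hsat : SatakeFrobCompatibleAt ι π.1 ρ v
    · exact hG K Rec n hcpt hn π ℓ ι ρ v hv hsat
    · obtain ⟨Rec₀, h₀⟩ := hS K ⟨Rec⟩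
      obtain ⟨πv, W, Wℂ, S, hFS, hloc, hW', htr, hcls, htrace⟩ :=
        h₀ n hcpt hn π hL ℓ ι ρ hirr hgeo hρ v hv hsat
      have hfs : Wℂ.HasFrobSemisimpleClass ((Rec₀.llc v).recGL n
          (Literature.NumberTheory.Automorphic.IrrClass.mk πv)) :=
        hN K Rec₀ n hcpt hn π hL ℓ ι ρ hirr hgeo hρ v hv πv hloc W Wℂ hW' htr S hFS hcls htrace
      obtain ⟨πv', r, rℂ, hloc', haway, habove, htrans, hclass⟩ :
          LocalGlobalCompatibleAt Rec₀ ι π.1 ρ v :=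
        ⟨πv, W, Wℂ, hloc, fun _ => hW', fun hv' => absurd hv' hv, htr, hfs⟩
      refine ⟨πv', r, rℂ, hloc', haway, habove, htrans, ?_⟩
      rw [← hRig K Rec₀ Rec n hcpt hn π hL v πv' hloc']
      exact hclass
  intro F _ _
  refine ⟨hR F, fun Rec n hn hcpt => ?_⟩
  have hRec := hA F Rec
  -- every finite place misses the prime 2 or the prime 3
  have hprime : ∀ v : IsDedekindDomain.HeightOneSpectrum (NumberField.RingOfIntegers F),
      ∃ (ℓ' : ℕ) (_ : Fact ℓ'.Prime), ((ℓ' : ℕ) : NumberField.RingOfIntegers F) ∉ v.asIdeal := by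
    intro v
    by_cases h2 : ((2 : ℕ) : NumberField.RingOfIntegers F) ∈ v.asIdeal
    · refine ⟨3, ⟨Nat.prime_three⟩, fun h3 => v.isPrime.ne_top ((Ideal.eq_top_iff_one _).2 ?_)⟩
      have h := v.asIdeal.sub_mem h3 h2
      have h1 : ((3 : ℕ) : NumberField.RingOfIntegers F) - ((2 : ℕ) : NumberField.RingOfIntegers F) = 1 := by
        push_cast; norm_num
      rwa [h1] at h
    · exact ⟨2, ⟨Nat.prime_two⟩, h2⟩
  -- geometric + compatible at EVERY finite place for irreducible Satake–Frobenius compatible pairs;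
  -- above ℓ the place is read through a prime below it (the prime switch, N0 = PrimeSwitchSplit)
  have hLGC : ∀ (π : Literature.NumberTheory.Automorphic.CuspidalAutomorphicRepData n F hcpt), π.1.IsLAlgebraic →
      ∀ (ℓ : ℕ) [Fact ℓ.Prime] (ι : PadicAlgCl ℓ ≃+* ℂ)
        (ρ : Literature.NumberTheory.GaloisRepresentations.FramedGaloisRep F (PadicAlgCl ℓ) n),
        ρ.toGaloisRep.IsIrreducible →
        (∀ᶠ v : IsDedekindDomain.HeightOneSpectrum (NumberField.RingOfIntegers F) in Filter.cofinite,
          SatakeFrobCompatibleAt ι π.1 ρ v) →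
        IsGeometricFramed Rec ρ ∧
          ∀ v : IsDedekindDomain.HeightOneSpectrum (NumberField.RingOfIntegers F),
            LocalGlobalCompatibleAt Rec ι π.1 ρ v := by
    intro π hL ℓ _ ι ρ hirr hρ
    have hgeo : (∀ᶠ v : IsDedekindDomain.HeightOneSpectrum (NumberField.RingOfIntegers F) in Filter.cofinite,
        ρ.IsUnramifiedAt v) ∧
        ∀ (v : IsDedekindDomain.HeightOneSpectrum (NumberField.RingOfIntegers F))
          (hv : ((ℓ : ℕ) : NumberField.RingOfIntegers F) ∈ v.asIdeal),
          (Literature.NumberTheory.PAdicHodge.fontainePstAdicCompletion v ℓ hv).IsDeRhamFramed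
            (ρ.toLocal v) :=
      ⟨hρ.mono fun v ⟨_, _, hur, _⟩ => hur, fun v hv => (hP F n hcpt hn π hL ℓ ι ρ hirr hρ v hv).1⟩
    refine ⟨hgeo, fun v => ?_⟩
    by_cases hv : ((ℓ : ℕ) : NumberField.RingOfIntegers F) ∈ v.asIdeal
    · obtain ⟨ℓ', _, hℓ'⟩ := hprime v
      obtain ⟨ι'⟩ := PadicAlgCl.nonempty_ringEquiv_complex ℓ'
      obtain ⟨ρ', hirr', hρ'⟩ := hW F n hcpt hn π hL ℓ' ι'
      have hgeo' : (∀ᶠ w : IsDedekindDomain.HeightOneSpectrum (NumberField.RingOfIntegers F) in Filter.cofinite,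
          ρ'.IsUnramifiedAt w) ∧
          ∀ (w : IsDedekindDomain.HeightOneSpectrum (NumberField.RingOfIntegers F))
            (hw : ((ℓ' : ℕ) : NumberField.RingOfIntegers F) ∈ w.asIdeal),
            (Literature.NumberTheory.PAdicHodge.fontainePstAdicCompletion w ℓ' hw).IsDeRhamFramed
              (ρ'.toLocal w) :=
        ⟨hρ'.mono fun w ⟨_, _, hur, _⟩ => hur,
          fun w hw => (hP F n hcpt hn π hL ℓ' ι' ρ' hirr' hρ' w hw).1⟩
      exact (hP F n hcpt hn π hL ℓ ι ρ hirr hρ v hv).2 Rec ℓ' ι' ρ' hℓ' hirr' hρ'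
        (hRec n hcpt hn π hL ℓ' ι' ρ' hirr' hgeo' hρ' v hℓ')
    · exact hRec n hcpt hn π hL ℓ ι ρ hirr hgeo hρ v hv
  refine ⟨?_, ?_⟩
  · -- (A) automorphic → Galois, uniqueness up to conjugacy from the proved support item U
    intro π hL ℓ _ ι
    obtain ⟨ρ, hirr, hρ⟩ := hW F n hcpt hn π hL ℓ ι
    obtain ⟨hgeo, hloc⟩ := hLGC π hL ℓ ι ρ hirr hρ
    exact ⟨ρ, hirr, hgeo, ⟨hρ, hloc⟩, fun ρ' h' => hU F n hcpt π ℓ ι ρ ρ' hirr hρ h'.1⟩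
  · -- (B) Galois → automorphic
    intro ℓ _ ι ρ hirr hgeo
    obtain ⟨π, hL, hρ⟩ := hB F n hcpt hn ℓ ι ρ hirr hgeo
    exact ⟨π, hL, hρ, (hLGC π hL ℓ ι ρ hirr hρ).2⟩

end Summit.Langlands.Langlands.Theses.RetentionCarving
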